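import Summits.ValiantsHypothesis.ValiantsHypothesis.Theorems.GrenetZeonDualUnipotentThreeHalvesHeavyTopInvariantFlag
import Summits.ValiantsHypothesis.ValiantsHypothesis.Theorems.GrenetZeonDualUnipotentThreeHalvesHeavyTopGradedFlag
import Summits.ValiantsHypothesis.ValiantsHypothesis.Theorems.GrenetZeonDualUnipotentThreeHalvesNilpotentPencilCore

/-!
# val-idea-27 g0 (WAVE-2, lens (b) representation-theoretic / weight argument) — Sketch for crux 24318 / R2 `HeavyTopLaw`

First-lemma signatures of the two crux idea cards `graded-shadow` and `pluecker-gap`.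
Nothing here is asserted as true: laws are `Prop`s, stubs are `sorry`.  VP ≠ VNP is NOT proved; R2 / 24318 untouched.

v1.10: **L1 `gradedCertificate` (the symmetric-certificate lemma) is PROVED — no stub below the law remains.**  New sorry-free
pieces: `finrank_gr_abstract` (rank of `gr U` = rank of `U`, for any finite family of orthogonal idempotents summing to `id` and the
flag they define; per-level rank–nullity + disjoint sups), its instances `L1_finrank_grSub` / `L1_finrank_grMat` (G1), and
`exists_adapted_basis` + `L1_adaptedFrame` (G6: a graded chain `⊤ = G 0 ≥ ⋯ ≥ G p = ⊥` is the coordinate flag `flagSub P' lvl'` of a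
frame with the SAME grading operator — cells = complements of `G (ℓ+1) ∩ V_k` in `G ℓ ∩ V_k`, basis via
`basisOfTopLeSpanOfCardEqFinrank`, `P'` = the coordinate matrix `b'.toMatrix (Pi.basisFun)`), `gradingOp_mulVec_of_fix`.
The file's ONLY `sorry` is `stub_threeWeightLaw` (L4 = the law, research rung).
v1.9 (= v1.8 + (G3') `L1_grIncidence` PROVED: incidence passes to `gr`, via the coordinate identity `wtComp_mulVec_wtDiag`
(pr_{a+d}(A w) = A_d pr_a w); remaining L1 stubs: `L1_finrank_grSub`, `L1_finrank_grMat`, `stub_adaptedFrame`).  v1.8 (= v1.7 + appendix `L1Decomposition`: L1 `gradedCertificate` DERIVED, sorry-free, from four linear-algebra stubs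
`L1_finrank_grSub`, `L1_finrank_grMat`, `stub_grIncidence`, `stub_adaptedFrame`; glue (E) entry↔evaluation, (S1) shifts↔flag incidence,
(B1/B2) rank–nullity, `gr` ⊤/monotone/graded, graded-space-in-its-gr all PROVED).  v1.7 (= v1.6 + the elementary L1 plan + K1c REFUTED: `not_shallowCertificatesDestabilise`,
via `irrPencil`, `pencilSpace_irrPencil = irrThreeSpace`, `finrank_irrThreeSpace = 2`, `irrPencil_certifies`).  Sorry-free part: `flagCheap_of_certifies`, `gradedHeavyTopLaw_of_heavyTopLaw`, `isGraded_of_isGradedPencil`,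
`oppositeWeight_trace` (L2: opposite weight components of a graded nilpotent pencil are trace-orthogonal), `gradedMassCriterion`
(L3: G″ read through a coarsening of the pencil's own grading), `unstable_of_strictUpper` (K0), `topHeavy_unstable` (SG ⇒ format
instability), `sum_clip_aux` + `plDeg_clipping` (K1a), `unstable_of_deepCertificate` (K1b: every DEEP uniform weight certificate
`p > r + c` of a top-heavy pencil space makes it Plücker-unstable), `irrThree_commutator`, `irrThree_commutator_sq_trace`,
`trace_comm_sq_eq_zero_of_wt` (the weight argument: `X ∈ F_{≥d}, Y ∈ F_{≥d'}, d + d' ≥ 1 ⇒ tr([X,Y]²) = 0`), `irrThree_semistable`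
(K2: MOR's `Irr₃` is Plücker-SEMISTABLE — `¬ PlUnstable irrThreeSpace`, kernel-checked).
Stubs (1): `stub_threeWeightLaw` (L4 = the law `ThreeWeightLaw` itself, research rung).  Everything else — K0, K1a, K1b, K2, the K1c
refutation, L1 (with its whole appendix), L2, L3 — is kernel-checked.
-/

set_option linter.dupNamespace false

noncomputable section

namespace Summit.ValiantsHypothesis.ValiantsHypothesis.Cruxes.DualUnipotentThreeHalves.WeightShadow

open MvPolynomial Matrix
open scoped BigOperators
open Summit.ValiantsHypothesis.ValiantsHypothesis.Cruxes.TwoDimCoefficients.DimTwoCases (AffMat IsAffine)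
open Summit.ValiantsHypothesis.ValiantsHypothesis.Theorems.GrenetZeon.RadicalSplit

variable {m : ℕ}

/-! ## Common weight vocabulary (a cocharacter = a basis change `P` and a level function `lvl`) -/

/-- Conjugation by a unit: `P M P⁻¹`. -/
def conj (P : (Matrix (Fin m) (Fin m) ℂ)ˣ) (M : Matrix (Fin m) (Fin m) ℂ) : Matrix (Fin m) (Fin m) ℂ :=
  (P : Matrix (Fin m) (Fin m) ℂ) * M * (↑P⁻¹ : Matrix (Fin m) (Fin m) ℂ)

/-- `conj` is multiplicative. -/
theorem conj_mul (P : (Matrix (Fin m) (Fin m) ℂ)ˣ) (X Y : Matrix (Fin m) (Fin m) ℂ) :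
    conj P (X * Y) = conj P X * conj P Y := by
  simp only [conj, Matrix.mul_assoc]
  rw [← Matrix.mul_assoc (↑P⁻¹ : Matrix (Fin m) (Fin m) ℂ) (P : Matrix (Fin m) (Fin m) ℂ), Units.inv_mul, Matrix.one_mul]

theorem conj_sub (P : (Matrix (Fin m) (Fin m) ℂ)ˣ) (X Y : Matrix (Fin m) (Fin m) ℂ) :
    conj P (X - Y) = conj P X - conj P Y := by
  simp [conj, Matrix.mul_sub, Matrix.sub_mul]

theorem trace_conj (P : (Matrix (Fin m) (Fin m) ℂ)ˣ) (M : Matrix (Fin m) (Fin m) ℂ) :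
    Matrix.trace (conj P M) = Matrix.trace M := by
  simp only [conj]
  rw [Matrix.trace_mul_cycle, Units.inv_mul, Matrix.one_mul]

/-- Torus weight of the position `(i, j)` (the map `e_j ↦ e_i`) under `t ↦ diag(t^{lvl i})`:
positive = climbs (the convention of `flagCheap_of_weight_levels`: `hK` kills `lvl i < lvl j + c`). -/
def wt (lvl : Fin m → ℕ) (i j : Fin m) : ℤ := (lvl i : ℤ) - lvl j

/-- The weight-`d` homogeneous component of a matrix (in the conjugated basis). -/
def wtComp (lvl : Fin m → ℕ) (d : ℤ) (M : Matrix (Fin m) (Fin m) ℂ) : Matrix (Fin m) (Fin m) ℂ :=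
  Matrix.of fun i j => if wt lvl i j = d then M i j else 0

/-- Matrices all of whose (conjugated) weights are `≥ d` — the `d`-th piece of the `λ`-FILTRATION of `M_m(ℂ)`. -/
def wtFilt (P : (Matrix (Fin m) (Fin m) ℂ)ˣ) (lvl : Fin m → ℕ) (d : ℤ) : Submodule ℂ (Matrix (Fin m) (Fin m) ℂ) :=
  Submodule.span ℂ {M | ∀ i j : Fin m, wt lvl i j < d → conj P M i j = 0}

/-- The nilpotent linear space of the pencil: `W(N) = ℂ·N(0) + N_lin(ℂ^{n×n})`. -/
def pencilSpace {n : ℕ} (N : AffMat n m) : Submodule ℂ (Matrix (Fin m) (Fin m) ℂ) :=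
  Submodule.span ℂ ({N.map (MvPolynomial.eval 0)} ∪ Set.range (linPart N))

/-- A linear space of nilpotent matrices. -/
def IsNilSpace (W : Submodule ℂ (Matrix (Fin m) (Fin m) ℂ)) : Prop := ∀ X ∈ W, IsNilpotent X

/-- The data `(P, lvl; p, r, c, K)` is a UNIFORM WEIGHT CERTIFICATE for `N`: exactly the hypotheses of
✓ `flagCheap_of_weight_levels` (G″, p645496); val-idea-26's `WeightThin` (card krylov-seed) is its existential closure. -/
def Certifies {n : ℕ} (N : AffMat n m) (P : (Matrix (Fin m) (Fin m) ℂ)ˣ) (lvl : Fin m → ℕ) (p r c : ℕ)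
    (K : Submodule ℂ (Fin n × Fin n → ℂ)) : Prop :=
  1 ≤ c ∧ (∀ i, lvl i < p) ∧
  (∀ i j : Fin m, lvl i + r < lvl j →
    ((P : Matrix (Fin m) (Fin m) ℂ).map C * N * (↑P⁻¹ : Matrix (Fin m) (Fin m) ℂ).map C :
      Matrix (Fin m) (Fin m) (MvPolynomial (Fin n × Fin n) ℂ)) i j = 0) ∧
  (∀ v ∈ K, ∀ i j : Fin m, lvl i < lvl j + c → conj P (linPart N v) i j = 0) ∧
  ((p - 1 + r * (n - 1)) / (c + r) + 1) * n < Module.finrank ℂ K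

/-- A certified pencil is flag-cheap (G″ verbatim). PROVED. -/
theorem flagCheap_of_certifies {n : ℕ} {N : AffMat n m} (hN : IsAffine N) {P : (Matrix (Fin m) (Fin m) ℂ)ˣ}
    {lvl : Fin m → ℕ} {p r c : ℕ} {K : Submodule ℂ (Fin n × Fin n → ℂ)} (h : Certifies N P lvl p r c K) :
    FlagCheap n m N := by
  obtain ⟨hc, hlvl, hdrop, hK, hdim⟩ := h
  exact Theorems.GrenetZeon.HeavyTopInvariantFlag.flagCheap_of_weight_levels N hN P lvl p r c hc hlvl hdrop K hK
    _ le_rfl hdim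

/-- The semisimple GRADING OPERATOR `P⁻¹·diag(lvl)·P` of the cocharacter `(P, lvl)` (its weight spaces are the levels). -/
def gradingOp (P : (Matrix (Fin m) (Fin m) ℂ)ˣ) (lvl : Fin m → ℕ) : Matrix (Fin m) (Fin m) ℂ :=
  conj P⁻¹ (Matrix.diagonal fun i => (lvl i : ℂ))

/-! ## Card `graded-shadow`: torus-GRADED pencils and the graded heavy-top law -/

/-- The pencil space is GRADED by the cocharacter `(P, lvl)`: stable under taking weight components
(equivalently: `t ↦ P⁻¹ diag(t^{lvl}) P` lies in the stabiliser of `W(N)` in `GL_m`). -/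
def IsGraded {n : ℕ} (N : AffMat n m) (P : (Matrix (Fin m) (Fin m) ℂ)ˣ) (lvl : Fin m → ℕ) : Prop :=
  ∀ M ∈ pencilSpace N, ∀ d : ℤ, conj P⁻¹ (wtComp lvl d (conj P M)) ∈ pencilSpace N

/-- The AFFINE PENCIL is graded (critic V03 price P1: the torus must stabilise the top space `𝒯 = range (linPart N)`
AND the affine structure, not only `W = ℂ·N(0) + 𝒯`): weight components of tops are tops, and `N(0)` is homogeneous
(so `τ(t)·N(0)·τ(t)⁻¹ = t^{d₀} N(0)` — a rescaling, which changes no support / flag condition). -/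
def IsGradedPencil {n : ℕ} (N : AffMat n m) (P : (Matrix (Fin m) (Fin m) ℂ)ˣ) (lvl : Fin m → ℕ) : Prop :=
  (∀ v : Fin n × Fin n → ℂ, ∀ d : ℤ, ∃ v' : Fin n × Fin n → ℂ,
      conj P⁻¹ (wtComp lvl d (conj P (linPart N v))) = linPart N v') ∧
  (∃ d₀ : ℤ, wtComp lvl d₀ (conj P (N.map (MvPolynomial.eval 0))) = conj P (N.map (MvPolynomial.eval 0)))

/-- A graded affine pencil has a graded pencil space (linear algebra: `wtComp` is linear, `pencilSpace` is a span). -/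
theorem conj_inv_conj (P : (Matrix (Fin m) (Fin m) ℂ)ˣ) (M : Matrix (Fin m) (Fin m) ℂ) :
    conj P⁻¹ (conj P M) = M := by
  simp only [conj, inv_inv]
  calc (↑P⁻¹ : Matrix (Fin m) (Fin m) ℂ) * ((P : Matrix (Fin m) (Fin m) ℂ) * M * (↑P⁻¹ : Matrix (Fin m) (Fin m) ℂ)) *
        (P : Matrix (Fin m) (Fin m) ℂ)
      = ((↑P⁻¹ : Matrix (Fin m) (Fin m) ℂ) * (P : Matrix (Fin m) (Fin m) ℂ)) * M *
        ((↑P⁻¹ : Matrix (Fin m) (Fin m) ℂ) * (P : Matrix (Fin m) (Fin m) ℂ)) := by simp only [Matrix.mul_assoc]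
    _ = M := by rw [Units.inv_mul, Matrix.one_mul, Matrix.mul_one]

theorem conj_conj_inv (P : (Matrix (Fin m) (Fin m) ℂ)ˣ) (M : Matrix (Fin m) (Fin m) ℂ) :
    conj P (conj P⁻¹ M) = M := by
  simp only [conj, inv_inv]
  calc (P : Matrix (Fin m) (Fin m) ℂ) * ((↑P⁻¹ : Matrix (Fin m) (Fin m) ℂ) * M * (P : Matrix (Fin m) (Fin m) ℂ)) *
        (↑P⁻¹ : Matrix (Fin m) (Fin m) ℂ)
      = ((P : Matrix (Fin m) (Fin m) ℂ) * (↑P⁻¹ : Matrix (Fin m) (Fin m) ℂ)) * M *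
        ((P : Matrix (Fin m) (Fin m) ℂ) * (↑P⁻¹ : Matrix (Fin m) (Fin m) ℂ)) := by simp only [Matrix.mul_assoc]
    _ = M := by rw [Units.mul_inv, Matrix.one_mul, Matrix.mul_one]

/-- A graded affine pencil has a graded pencil space (PROVED v1.6; linear algebra: the weight projector
`M ↦ P⁻¹ (P M P⁻¹)_d P` is linear and maps the generators of `pencilSpace N` into it). -/
theorem isGraded_of_isGradedPencil {n : ℕ} (N : AffMat n m) (P : (Matrix (Fin m) (Fin m) ℂ)ˣ) (lvl : Fin m → ℕ)
    (h : IsGradedPencil N P lvl) : IsGraded N P lvl := by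
  obtain ⟨htop, d₀, hd₀⟩ := h
  intro M hM d
  have hadd : ∀ X Y : Matrix (Fin m) (Fin m) ℂ, conj P⁻¹ (wtComp lvl d (conj P (X + Y))) =
      conj P⁻¹ (wtComp lvl d (conj P X)) + conj P⁻¹ (wtComp lvl d (conj P Y)) := by
    intro X Y
    have e : wtComp lvl d (conj P (X + Y)) = wtComp lvl d (conj P X) + wtComp lvl d (conj P Y) := by
      ext i j
      simp only [wtComp, conj, Matrix.of_apply, Matrix.add_apply, Matrix.mul_add, Matrix.add_mul]
      split_ifs <;> simp
    rw [e]
    simp [conj, Matrix.mul_add, Matrix.add_mul]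
  have hsmul : ∀ (a : ℂ) (X : Matrix (Fin m) (Fin m) ℂ), conj P⁻¹ (wtComp lvl d (conj P (a • X))) =
      a • conj P⁻¹ (wtComp lvl d (conj P X)) := by
    intro a X
    have e : wtComp lvl d (conj P (a • X)) = a • wtComp lvl d (conj P X) := by
      ext i j
      simp only [wtComp, conj, Matrix.of_apply, Matrix.smul_apply, Matrix.mul_smul, Matrix.smul_mul]
      split_ifs <;> simp
    rw [e]
    simp [conj]
  induction hM using Submodule.span_induction with
  | mem x hx =>
      rcases hx with hx | ⟨v, rfl⟩
      · rw [Set.mem_singleton_iff] at hx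
        subst hx
        by_cases hd : d = d₀
        · subst hd
          rw [hd₀, conj_inv_conj]
          exact Submodule.subset_span (Or.inl rfl)
        · have e : wtComp lvl d (conj P (N.map (MvPolynomial.eval 0))) = 0 := by
            rw [← hd₀]
            ext i j
            simp only [wtComp, Matrix.of_apply, Matrix.zero_apply]
            split_ifs with h1 h2
            · exact absurd (h1.symm.trans h2) hd
            · rfl
            · rfl
          rw [e]
          simp [conj]
      · obtain ⟨v', hv'⟩ := htop v d
        rw [hv']
        exact Submodule.subset_span (Or.inr ⟨v', rfl⟩)
  | zero =>
      have e : wtComp lvl d (conj P 0) = 0 := by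
        ext i j; simp [wtComp, conj]
      rw [e]
      simp [conj]
  | add x y _ _ hx hy => rw [hadd]; exact add_mem hx hy
  | smul a x _ hx => rw [hsmul]; exact Submodule.smul_mem _ a hx

/-- **GHTL — the torus-graded heavy-top law** (R2 restricted to pencils whose nilpotent space has a non-central
one-parameter symmetry).  Contains every heavy-top family of the census (L_k, B(a,b), MOR-inflations: 3 weights). -/
def GradedHeavyTopLaw : Prop :=
  ∃ C₀ n₀ : ℕ, ∀ n ≥ n₀, ∀ m : ℕ, C₀ * m ^ 2 < n ^ 3 → ∀ N : AffMat n m, IsAffine N → N ^ m = 0 →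
    (∃ (P : (Matrix (Fin m) (Fin m) ℂ)ˣ) (lvl : Fin m → ℕ), (∃ i j, lvl i ≠ lvl j) ∧ IsGradedPencil N P lvl) →
    (∀ K : Submodule ℂ (Fin n × Fin n → ℂ), RadOrth n m N K →
      Module.finrank ℂ K ≤ 16 * m * Nat.sqrt n + 16 * n) →
    FlagCheap n m N

/-- GHTL is a sub-case of R2 (sanity: the restriction is by an extra hypothesis). -/
theorem gradedHeavyTopLaw_of_heavyTopLaw : HeavyTopLaw → GradedHeavyTopLaw := by
  rintro ⟨C₀, n₀, h⟩
  exact ⟨C₀, n₀, fun n hn m hm N hN hnil _ hK => h n hn m hm N hN hnil hK⟩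

/-! **SYMMETRIC-CERTIFICATE LEMMA (L1) — now the THEOREM `gradedCertificate` of the appendix
`L1Decomposition` below (v1.10: FULLY PROVED, no stub; v1.8 had derived it from four linear-algebra stubs).**
**Statement:** `IsAffine N → IsGradedPencil N P lvl → Certifies N P₁ lvl₁ p r c K → ∃ P' lvl₀ lvl' K', gradingOp P' lvl₀ = gradingOp P lvl ∧
Certifies N P' lvl' p r c K'`.  ORIGINAL GLOSS: **SYMMETRIC-CERTIFICATE LEMMA (first lemma of `graded-shadow`, provable: Borel fixed point).**  The certifying
filtrations `{F : W ⊆ F_{≥−r}, dim(𝒯 ∩ F_{≥c}) ≥ M}` form a CLOSED, `Stab(W)`-stable subvariety of a partial flag variety; a torus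
`𝕋 ⊆ Stab(𝒯) ∩ Stab(ℂ·N(0))` (= a grading of the AFFINE pencil, `IsGradedPencil`; V03 price P1) therefore fixes one of them:
a graded pencil that is uniformly weight-certified is certified by a cocharacter COMMUTING with its grading (same `p, r, c`).
Constructively the fixed flag is the limit flag `F⁰_j = ⊕_i pr_i (F_j ∩ V_{≥ i})` (HOME/CLOSEDNESS.md).
ELEMENTARY PROOF PLAN (v1.7, HOME/CLOSEDNESS.md § «L1 made elementary» — no Borel, no properness, no semicontinuity): with
`gr U := ⊕_a pr_a (U ∩ V_{≥a})` for subspaces of `V = ⊕ V_a` and of `gl_m = ⊕ gl_m(d)` (ad-grading), (G1) `dim gr U = dim U`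
(telescoping: `ker (pr_a | U ∩ V_{≥a}) = U ∩ V_{>a}`), (G2) `gr` is monotone, (G3) for `X ∈ 𝒞 ∩ gl_{≥d}`, `u ∈ F_j ∩ V_{≥a}`:
`pr_{a+d} (X u) = X_d (pr_a u)`, so an incidence pattern `X F_j ≤ F_{j'}` valid on `𝒞` holds for `gr 𝒞` on `gr F•`, (G4)
`dim L⁻¹(𝒞') = dim (𝒞' ∩ range L) + dim ker L`.  Drops: every element of `W = pencilSpace N` obeys the `r`-drop pattern w.r.t. `F•`
(hdrop at all evaluation points) and by `IsGradedPencil` so does each of its homogeneous components, hence (G3) w.r.t. `gr F•`.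
Climbs + mass: `𝒞 := {X ∈ 𝒯 : X climbs c w.r.t. F•} ⊇ L(K)`, `gr 𝒞 ≤ 𝒯` climbs `c` w.r.t. `gr F•` (G3), and
`K' := L⁻¹(gr 𝒞)` has `dim K' = dim gr 𝒞 + dim ker L ≥ dim L(K) + dim ker L ≥ dim K` (G1, G4) — the budget inequality survives
verbatim.  Frame: bases of the `V_a` adapted to the graded flag `gr F•` give `P'` with `gradingOp P' lvl₀ = gradingOp P lvl` and
`gr F•` a coordinate flag with the level multiset of `lvl₁`.  STATUS (v1.10): this plan is CARRIED OUT IN KERNEL — see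
`gradedCertificate` in the appendix `L1Decomposition` (sorry-free, ≈ 700 Lean lines: `finrank_gr_abstract`, `exists_adapted_basis`,
`L1_adaptedFrame`, `L1_grIncidence`, rank–nullity glue). -/

/-- **FIRST LEMMA of `graded-shadow` (open rung): the THREE-WEIGHT graded heavy-top law.**  Three levels suffice to
contain L_k, B(a,b) and every MOR-inflation; the balanced class `{[[0,B],[C,0]]}` is its two-weight sub-case. -/
def ThreeWeightLaw : Prop :=
  ∃ C₀ n₀ : ℕ, ∀ n ≥ n₀, ∀ m : ℕ, C₀ * m ^ 2 < n ^ 3 → ∀ N : AffMat n m, IsAffine N → N ^ m = 0 →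
    (∃ (P : (Matrix (Fin m) (Fin m) ℂ)ˣ) (lvl : Fin m → ℕ),
      (∀ i, lvl i < 3) ∧ (∃ i j, lvl i ≠ lvl j) ∧ IsGradedPencil N P lvl) →
    (∀ K : Submodule ℂ (Fin n × Fin n → ℂ), RadOrth n m N K →
      Module.finrank ℂ K ≤ 16 * m * Nat.sqrt n + 16 * n) →
    FlagCheap n m N

theorem stub_threeWeightLaw : ThreeWeightLaw := by
  sorry

/-- **Opposite weights are trace-orthogonal** on a graded nilpotent pencil (`tr(XY) = 0` on `W` — the `k = 1` symmetrised
trace identity — applied to homogeneous components, which lie in `W` by gradedness).  The first inequality of the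
mass calculus: `μ(d) + μ(−d) ≤ dim gl_m(d)`. -/
theorem pencilSpace_le_sup {n : ℕ} (N : AffMat n m) (T : (Fin n × Fin n → ℂ) →ₗ[ℂ] Matrix (Fin m) (Fin m) ℂ)
    (hT : ∀ v, T v = linPart N v) :
    pencilSpace N ≤ Submodule.span ℂ {N.map (MvPolynomial.eval 0)} ⊔ LinearMap.range T := by
  apply Submodule.span_le.2
  rintro M (hM | ⟨v, rfl⟩)
  · exact Submodule.mem_sup_left (Submodule.subset_span hM)
  · apply Submodule.mem_sup_right
    rw [← hT]
    exact LinearMap.mem_range_self T v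

/-- The pencil space of an affine nilpotent pencil is a nil space (✓ `isNilpotent_of_mem_span_sup_range`, GradedFlag). -/
theorem isNilpotent_of_mem_pencilSpace {n : ℕ} (N : AffMat n m) (hN : IsAffine N) (hnil : N ^ m = 0)
    {M : Matrix (Fin m) (Fin m) ℂ} (hM : M ∈ pencilSpace N) : IsNilpotent M := by
  obtain ⟨T, hT⟩ := exists_topMap_linPart N hN
  exact Summit.ValiantsHypothesis.ValiantsHypothesis.Theorems.GrenetZeon.HeavyTopGradedFlag.isNilpotent_of_mem_span_sup_range
    N hN hnil T hT M (pencilSpace_le_sup N T hT hM)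

/-- **Opposite weights are trace-orthogonal (L2 — PROVED v1.6)** on a graded nilpotent pencil: the homogeneous components of
elements of `W` are conjugates of elements of `W` (gradedness), `W` is a nil SPACE, and `tr(AB) = 0` for `A, B` in a nil space
(✓ `trace_pow_mul_eq_zero_of_pencil`, k = 1).  First inequality of the mass calculus: `μ(d) + μ(−d) ≤ dim gl_m(d)`. -/
theorem oppositeWeight_trace {n : ℕ} (N : AffMat n m) (hN : IsAffine N) (hnil : N ^ m = 0)
    (P : (Matrix (Fin m) (Fin m) ℂ)ˣ) (lvl : Fin m → ℕ) (hgr : IsGraded N P lvl)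
    (M M' : Matrix (Fin m) (Fin m) ℂ) (hM : M ∈ pencilSpace N) (hM' : M' ∈ pencilSpace N) (d : ℤ) :
    Matrix.trace (wtComp lvl d (conj P M) * wtComp lvl (-d) (conj P M')) = 0 := by
  have hA := hgr M hM d
  have hB := hgr M' hM' (-d)
  rw [← conj_conj_inv P (wtComp lvl d (conj P M)), ← conj_conj_inv P (wtComp lvl (-d) (conj P M')), ← conj_mul,
    trace_conj]
  have h := trace_pow_mul_eq_zero_of_pencil (conj P⁻¹ (wtComp lvl d (conj P M)))
    (conj P⁻¹ (wtComp lvl (-d) (conj P M')))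
    (fun t => isNilpotent_of_mem_pencilSpace N hN hnil (Submodule.add_mem _ hA (Submodule.smul_mem _ t hB))) 1
  simpa using h

/-- **Graded mass criterion (L3 — PROVED v1.6)** (G″ read on a graded pencil through a COARSENING of its own grading by the scale `s`):
drop depth `r₀`, `p` fine levels; if the tops of fine weight `≥ s` have codimension `< j·n` and
`p + r₀·j ≤ s·(n − 2j) − 2s`, the pencil is flag-cheap.  Proof: `flagCheap_of_weight_levels` with
`lvl' = lvl / s`, `p' = (p−1)/s + 1`, `r' = ⌈r₀/s⌉`, `c' = 1`, `k = (p'−1 + r'(n−1))/(1+r') ≤ n − j − 1`. -/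
theorem gradedMassCriterion {n : ℕ} (N : AffMat n m) (hN : IsAffine N)
    (P : (Matrix (Fin m) (Fin m) ℂ)ˣ) (lvl : Fin m → ℕ) (p r₀ s j : ℕ) (hs : 1 ≤ s) (hlvl : ∀ i, lvl i < p)
    (hdrop : ∀ i j : Fin m, lvl i + r₀ < lvl j →
      ((P : Matrix (Fin m) (Fin m) ℂ).map C * N * (↑P⁻¹ : Matrix (Fin m) (Fin m) ℂ).map C :
        Matrix (Fin m) (Fin m) (MvPolynomial (Fin n × Fin n) ℂ)) i j = 0)
    (K : Submodule ℂ (Fin n × Fin n → ℂ))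
    (hK : ∀ v ∈ K, ∀ i j : Fin m, wt lvl i j < s → conj P (linPart N v) i j = 0)
    (hscale : p + r₀ * j + 2 * s ≤ s * (n - 2 * j)) (hmass : n ^ 2 < j * n + Module.finrank ℂ K) :
    FlagCheap n m N := by
  have hs0 : 0 < s := hs
  obtain ⟨s₁, rfl⟩ : ∃ s₁, s = s₁ + 1 := ⟨s - 1, by omega⟩
  set p'' := (p - 1) / (s₁ + 1) with hp''
  set r' := (r₀ + s₁) / (s₁ + 1) with hr'
  have F1 : (s₁ + 1) * p'' ≤ p := (Nat.mul_div_le (p - 1) (s₁ + 1)).trans (Nat.sub_le p 1)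
  have F2 : (s₁ + 1) * r' ≤ r₀ + s₁ := Nat.mul_div_le (r₀ + s₁) (s₁ + 1)
  have F3 : r₀ ≤ (s₁ + 1) * r' := by
    have h := Nat.lt_mul_div_succ (r₀ + s₁) hs0
    rw [Nat.mul_add, Nat.mul_one, ← hr'] at h
    omega
  -- the format forces `n ≥ 2j + 2`
  have hn2 : 2 * j + 2 ≤ n := by
    by_contra hcon
    have h1 : n - 2 * j ≤ 1 := by omega
    have h2 := Nat.mul_le_mul_left (s₁ + 1) h1
    rw [Nat.mul_one] at h2
    omega
  obtain ⟨t, ht⟩ : ∃ t, n = 2 * j + 2 + t := ⟨n - (2 * j + 2), by omega⟩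
  have hsc : p + r₀ * j + 2 * (s₁ + 1) ≤ (s₁ + 1) * (t + 2) := by
    have e : n - 2 * j = t + 2 := by omega
    rw [e] at hscale
    exact hscale
  -- main inequality `X := p'' + r'·j ≤ n − j − 2`
  have hX : p'' + r' * j ≤ j + t := by
    have h1 : (s₁ + 1) * (p'' + r' * j) ≤ (s₁ + 1) * (j + t) := by
      nlinarith [Nat.mul_le_mul_right j F2, F1, hsc]
    exact Nat.le_of_mul_le_mul_left h1 hs0
  -- the G″ budget `k ≤ n − j − 1`
  set k := (p'' + r' * (n - 1)) / (1 + r') with hk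
  have hk_le : k ≤ j + t + 1 := by
    apply Nat.div_le_of_le_mul
    have e : n - 1 = 2 * j + 1 + t := by omega
    rw [e]
    nlinarith [hX]
  have hdim : (k + 1) * n < Module.finrank ℂ K := by
    have h1 : (k + 1) * n ≤ (j + t + 2) * n := Nat.mul_le_mul_right n (by omega)
    have h2 : (j + t + 2) * n + j * n = n ^ 2 := by rw [ht]; ring
    omega
  refine Theorems.GrenetZeon.HeavyTopInvariantFlag.flagCheap_of_weight_levels N hN P (fun i => lvl i / (s₁ + 1))
    (p'' + 1) r' 1 le_rfl ?_ ?_ K ?_ k (by simp [hk]) hdim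
  · -- levels
    intro i
    have h : lvl i / (s₁ + 1) ≤ (p - 1) / (s₁ + 1) := Nat.div_le_div_right (by have := hlvl i; omega)
    show lvl i / (s₁ + 1) < p'' + 1
    omega
  · -- drops: `⌊lvl i/s⌋ + r' < ⌊lvl j/s⌋ ⇒ lvl i + r₀ < lvl j`
    intro i j' hij
    apply hdrop i j'
    have a1 := Nat.lt_mul_div_succ (lvl i) hs0
    have a2 := Nat.mul_div_le (lvl j') (s₁ + 1)
    have hij' : lvl i / (s₁ + 1) + r' + 1 ≤ lvl j' / (s₁ + 1) := hij
    have a3 := Nat.mul_le_mul_left (s₁ + 1) hij'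
    rw [Nat.mul_add, Nat.mul_add, Nat.mul_one] at a3
    rw [Nat.mul_add, Nat.mul_one] at a1
    generalize (s₁ + 1) * (lvl i / (s₁ + 1)) = A at a1 a3
    generalize (s₁ + 1) * (lvl j' / (s₁ + 1)) = B at a2 a3
    generalize (s₁ + 1) * r' = R at F3 a3
    omega
  · -- climbs: `⌊lvl i/s⌋ < ⌊lvl j/s⌋ + 1 ⇒ lvl i − lvl j < s`
    intro v hv i j' hij
    have h := hK v hv i j'
    simp only [conj] at h
    apply h
    simp only [wt]
    have a1 := Nat.lt_mul_div_succ (lvl i) hs0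
    have a2 := Nat.mul_div_le (lvl j') (s₁ + 1)
    have a3 := Nat.mul_le_mul_left (s₁ + 1) (show lvl i / (s₁ + 1) ≤ lvl j' / (s₁ + 1) by omega)
    rw [Nat.mul_add, Nat.mul_one] at a1
    generalize (s₁ + 1) * (lvl i / (s₁ + 1)) = A at a1 a3
    generalize (s₁ + 1) * (lvl j' / (s₁ + 1)) = B at a2 a3
    push_cast
    omega

/-! ## Card `pluecker-gap`: Hilbert–Mumford (in)stability of the point `[W] ∈ Gr(D, gl_m)` -/

/-- The **Plücker (Hilbert–Mumford) degree** of `W` along the cocharacter `(P, lvl)` (`p` levels):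
`Σ_X (lowest weight of X)` over a basis adapted to the `λ`-filtration, computed by Abel summation from the
filtration dimensions `f(d) = dim (W ⊓ wtFilt d)`.  `[W]` is `λ`-UNSTABLE iff this is `> 0`. -/
def plDeg (W : Submodule ℂ (Matrix (Fin m) (Fin m) ℂ)) (P : (Matrix (Fin m) (Fin m) ℂ)ˣ) (lvl : Fin m → ℕ)
    (p : ℕ) : ℤ :=
  (∑ d ∈ Finset.Icc (1 : ℤ) p, (Module.finrank ℂ ↥(W ⊓ wtFilt P lvl d) : ℤ)) -
    ∑ d ∈ Finset.Icc (1 - (p : ℤ)) 0,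
      ((Module.finrank ℂ W : ℤ) - (Module.finrank ℂ ↥(W ⊓ wtFilt P lvl d) : ℤ))

/-- `[W]` is Hilbert–Mumford UNSTABLE in the Plücker embedding of the Grassmannian (some cocharacter of `GL_m`
gives it positive degree); `¬ PlUnstable W` = SEMISTABLE (some `SL_m`-invariant of `Λ^D gl_m` is nonzero at `W`). -/
def PlUnstable (W : Submodule ℂ (Matrix (Fin m) (Fin m) ℂ)) : Prop :=
  ∃ (P : (Matrix (Fin m) (Fin m) ℂ)ˣ) (lvl : Fin m → ℕ) (p : ℕ), (∀ i, lvl i < p) ∧ 0 < plDeg W P lvl p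

/-- Triangularisable spaces are unstable (`ρ`-cocharacter: every element has lowest weight `≥ 1`, degree `≥ dim W`);
more generally EVERY uniform flag certificate of the tree (R1 Loewy flag, Theorem G/G′ invariant flag, G″ weight flag
with `c·dim W_{≥c} > r·codim`) forces `PlUnstable`.  Instance typed: the strictly-upper case. -/
theorem unstable_of_strictUpper (W : Submodule ℂ (Matrix (Fin m) (Fin m) ℂ)) (hW : W ≠ ⊥)
    (hup : ∀ X ∈ W, ∀ i j : Fin m, j ≤ i → X i j = 0) : PlUnstable W := by
  classical
  obtain ⟨X, hXW, hX0⟩ := (Submodule.ne_bot_iff W).1 hW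
  obtain ⟨i₀, j₀, -⟩ : ∃ i j : Fin m, X i j ≠ 0 := by
    by_contra h
    push Not at h
    exact hX0 (Matrix.ext h)
  have hm : 1 ≤ m := i₀.pos
  set lvl : Fin m → ℕ := fun i => m - 1 - (i : ℕ) with hlvl_def
  have hle : ∀ d : ℤ, d ≤ 1 → W ≤ wtFilt 1 lvl d := by
    intro d hd Y hY
    apply Submodule.subset_span
    intro i j hw
    have hconj : conj 1 Y = Y := by simp [conj]
    rw [hconj]
    apply hup Y hY
    by_contra hji
    push Not at hji
    have hji' : (i : ℕ) < (j : ℕ) := hji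
    have hi := i.isLt
    have hj := j.isLt
    simp only [wt, hlvl_def] at hw
    omega
  have hinf : ∀ d : ℤ, d ≤ 1 → W ⊓ wtFilt 1 lvl d = W := fun d hd => inf_eq_left.2 (hle d hd)
  have hpos : 0 < (Module.finrank ℂ W : ℤ) := by
    have : 0 < Module.finrank ℂ W :=
      Module.finrank_pos_iff_exists_ne_zero.2 ⟨⟨X, hXW⟩, fun h => hX0 (by simpa using congrArg Subtype.val h)⟩
    exact_mod_cast this
  refine ⟨1, lvl, m, fun i => ?_, ?_⟩
  · have hi := i.isLt
    simp only [hlvl_def]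
    omega
  · unfold plDeg
    have h2 : ∑ d ∈ Finset.Icc (1 - (m : ℤ)) 0,
        ((Module.finrank ℂ W : ℤ) - (Module.finrank ℂ ↥(W ⊓ wtFilt 1 lvl d) : ℤ)) = 0 := by
      apply Finset.sum_eq_zero
      intro d hd
      rw [Finset.mem_Icc] at hd
      rw [hinf d (by linarith [hd.2])]
      exact sub_self _
    have h1 : (Module.finrank ℂ W : ℤ) ≤
        ∑ d ∈ Finset.Icc (1 : ℤ) m, (Module.finrank ℂ ↥(W ⊓ wtFilt 1 lvl d) : ℤ) := by
      have hmem : (1 : ℤ) ∈ Finset.Icc (1 : ℤ) m := by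
        rw [Finset.mem_Icc]
        exact ⟨le_rfl, by exact_mod_cast hm⟩
      have hsum := Finset.single_le_sum
        (f := fun d : ℤ => (Module.finrank ℂ ↥(W ⊓ wtFilt 1 lvl d) : ℤ))
        (fun d _ => by positivity) hmem
      rw [hinf 1 le_rfl] at hsum
      exact hsum
    rw [h2]
    linarith

/-- Arithmetic core of the clipping inequality: an antitone `f : ℤ → ℤ` with `0 ≤ f ≤ D` and `f = D` on `(−∞, −r]`. -/
theorem sum_clip_aux (f : ℤ → ℤ) (D : ℤ) (p r c : ℕ) (hcp : c ≤ p)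
    (anti : ∀ d d' : ℤ, d ≤ d' → f d' ≤ f d) (fleD : ∀ d, f d ≤ D) (fnn : ∀ d, 0 ≤ f d)
    (flow : ∀ d : ℤ, d ≤ -(r : ℤ) → f d = D) :
    ((c : ℤ) + r) * f c - r * D ≤
      (∑ d ∈ Finset.Icc (1 : ℤ) p, f d) - ∑ d ∈ Finset.Icc (1 - (p : ℤ)) 0, (D - f d) := by
  classical
  have h1 : (c : ℤ) * f c ≤ ∑ d ∈ Finset.Icc (1 : ℤ) p, f d := by
    calc (c : ℤ) * f c = ∑ _d ∈ Finset.Icc (1 : ℤ) c, f c := by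
            rw [Finset.sum_const, Int.card_Icc, nsmul_eq_mul]
            simp
      _ ≤ ∑ d ∈ Finset.Icc (1 : ℤ) c, f d :=
            Finset.sum_le_sum fun d hd => anti d c (by rw [Finset.mem_Icc] at hd; exact hd.2)
      _ ≤ ∑ d ∈ Finset.Icc (1 : ℤ) p, f d :=
            Finset.sum_le_sum_of_subset_of_nonneg
              (Finset.Icc_subset_Icc_right (by exact_mod_cast hcp)) (fun d _ _ => fnn d)
  have h2 : ∑ d ∈ Finset.Icc (1 - (p : ℤ)) 0, (D - f d) ≤ r * (D - f c) := by
    calc ∑ d ∈ Finset.Icc (1 - (p : ℤ)) 0, (D - f d)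
        ≤ ∑ d ∈ Finset.Icc (1 - (p : ℤ)) 0, (if -(r : ℤ) < d then D - f c else 0) := by
          apply Finset.sum_le_sum
          intro d hd
          rw [Finset.mem_Icc] at hd
          split_ifs with h
          · linarith [anti d c (by linarith : d ≤ (c : ℤ))]
          · rw [flow d (not_lt.1 h)]
            simp
      _ = ∑ _d ∈ (Finset.Icc (1 - (p : ℤ)) 0).filter (fun d => -(r : ℤ) < d), (D - f c) := by
          rw [Finset.sum_filter]
      _ = (((Finset.Icc (1 - (p : ℤ)) 0).filter (fun d => -(r : ℤ) < d)).card : ℤ) * (D - f c) := by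
          rw [Finset.sum_const, nsmul_eq_mul]
      _ ≤ r * (D - f c) := by
          apply mul_le_mul_of_nonneg_right _ (by linarith [fleD c])
          have hsub : (Finset.Icc (1 - (p : ℤ)) 0).filter (fun d => -(r : ℤ) < d) ⊆
              Finset.Icc (1 - (r : ℤ)) 0 := by
            intro d hd
            rw [Finset.mem_filter, Finset.mem_Icc] at hd
            rw [Finset.mem_Icc]
            constructor <;> linarith [hd.1.1, hd.1.2, hd.2]
          calc (((Finset.Icc (1 - (p : ℤ)) 0).filter (fun d => -(r : ℤ) < d)).card : ℤ)
              ≤ (Finset.Icc (1 - (r : ℤ)) 0).card := by exact_mod_cast Finset.card_le_card hsub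
            _ = r := by
              rw [Int.card_Icc]
              simp
  linarith [h1, h2]

/-- **CLIPPING INEQUALITY (K1a, pure GIT bookkeeping — PROVED v1.4):** if every element of `W` has `λ`-weights `≥ −r`
then `plDeg ≥ (c + r)·dim(W ∩ F_{≥c}) − r·dim W` — the certificate functional `Ψ_{r,c} = Σ_X ψ(lowest wt X)`,
`ψ = c` on `[c,∞)`, `ψ = −r` on `[−r,c)`, satisfies `ψ ≤ id` on `[−r,∞)`, and `plDeg = Σ_X lowest wt X` (Abel summation). -/
theorem plDeg_clipping (W : Submodule ℂ (Matrix (Fin m) (Fin m) ℂ)) (P : (Matrix (Fin m) (Fin m) ℂ)ˣ)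
    (lvl : Fin m → ℕ) (p r c : ℕ) (hcp : c ≤ p) (hlow : W ≤ wtFilt P lvl (-(r : ℤ))) :
    ((c : ℤ) + r) * (Module.finrank ℂ ↥(W ⊓ wtFilt P lvl c) : ℤ) - r * (Module.finrank ℂ W : ℤ) ≤
      plDeg W P lvl p := by
  have filt_anti : ∀ d d' : ℤ, d ≤ d' → wtFilt P lvl d' ≤ wtFilt P lvl d := by
    intro d d' hdd'
    apply Submodule.span_mono
    intro M hM i j hw
    exact hM i j (lt_of_lt_of_le hw hdd')
  have anti : ∀ d d' : ℤ, d ≤ d' →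
      (Module.finrank ℂ ↥(W ⊓ wtFilt P lvl d') : ℤ) ≤ (Module.finrank ℂ ↥(W ⊓ wtFilt P lvl d) : ℤ) := by
    intro d d' hdd'
    exact_mod_cast Submodule.finrank_mono (inf_le_inf_left W (filt_anti d d' hdd'))
  have fleD : ∀ d : ℤ, (Module.finrank ℂ ↥(W ⊓ wtFilt P lvl d) : ℤ) ≤ (Module.finrank ℂ W : ℤ) := by
    intro d
    exact_mod_cast Submodule.finrank_mono (inf_le_left : W ⊓ wtFilt P lvl d ≤ W)
  have fnn : ∀ d : ℤ, (0 : ℤ) ≤ (Module.finrank ℂ ↥(W ⊓ wtFilt P lvl d) : ℤ) := fun d => by positivity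
  have flow : ∀ d : ℤ, d ≤ -(r : ℤ) →
      (Module.finrank ℂ ↥(W ⊓ wtFilt P lvl d) : ℤ) = (Module.finrank ℂ W : ℤ) := by
    intro d hd
    have : W ⊓ wtFilt P lvl d = W := inf_eq_left.2 (le_trans hlow (filt_anti d _ hd))
    rw [this]
  have := sum_clip_aux (fun d => (Module.finrank ℂ ↥(W ⊓ wtFilt P lvl d) : ℤ)) (Module.finrank ℂ W : ℤ)
    p r c hcp anti fleD fnn flow
  simpa [plDeg] using this

/-- **DEEP uniform weight certificates destabilise `[W]` (K1b — PROVED v1.4, the exact constant).**  From a certificate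
`(P, lvl; p, r, c, K)` of a top-heavy affine pencil (`n² ≤ dim W + n`): `W ≤ F_{≥−r}` (by `hdrop`, evaluating the conjugated
polynomial matrix), `dim(W ∩ F_{≥c}) ≥ dim T(K) ≥ dim K − dim ker T ≥ dim K + dim W − 1 − n²` (tops of `K` climb; rank–nullity for the
top map `T` and `W ≤ ℂ·N(0) + range T`), and the clipping inequality K1a gives
`plDeg ≥ (c+r)·dim(W ∩ F_{≥c}) − r·dim W ≥ n(p − r) + c(dim W − n²) ≥ n·(p − r − c) > 0`
as soon as the certificate is DEEP: `p > r + c` (with G″'s budget `((p−1+r(n−1))/(c+r) + 1)·n < dim K`).  Every `r = 0` certificate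
(R1 Loewy flags, Theorem G/G′: `c = 1 < p`) is deep; so is G″ on `L_k`, `B(a,b)`, the MOR-inflations.  SHALLOW drop-certificates
(`p ≤ r + c`, e.g. `p = 2, r = c = 1`) are NOT covered: there the bound is `≥ 0`, not `> 0`; whether they still force instability is
OPEN (K1c below).  CONTRAPOSITIVE (the kill-switch, now a theorem for deep certificates): a Plücker-SEMISTABLE top-heavy pencil space
admits NO deep uniform weight certificate. -/
theorem unstable_of_deepCertificate {n : ℕ} {N : AffMat n m} (hN : IsAffine N)
    {P : (Matrix (Fin m) (Fin m) ℂ)ˣ} {lvl : Fin m → ℕ} {p r c : ℕ} {K : Submodule ℂ (Fin n × Fin n → ℂ)}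
    (h : Certifies N P lvl p r c K) (hdeep : r + c < p) (hn : 1 ≤ n)
    (htop : n ^ 2 ≤ Module.finrank ℂ (pencilSpace N) + n) :
    PlUnstable (pencilSpace N) := by
  classical
  obtain ⟨hc, hlvl, hdrop, hK, hdim⟩ := h
  -- (1) conjugated evaluations vanish where the certificate drops more than `r`
  have hconj_eval : ∀ (x : Fin n × Fin n → ℂ) (i j : Fin m), lvl i + r < lvl j →
      conj P (N.map (MvPolynomial.eval x)) i j = 0 := by
    intro x i j hij
    have key : (((P : Matrix (Fin m) (Fin m) ℂ).map C * N * (↑P⁻¹ : Matrix (Fin m) (Fin m) ℂ).map C :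
        Matrix (Fin m) (Fin m) (MvPolynomial (Fin n × Fin n) ℂ))).map (MvPolynomial.eval x)
        = conj P (N.map (MvPolynomial.eval x)) := by
      simp only [Matrix.map_mul, Matrix.map_map, Function.comp_def, MvPolynomial.eval_C, Matrix.map_id', conj]
    have hentry : conj P (N.map (MvPolynomial.eval x)) i j =
        MvPolynomial.eval x ((((P : Matrix (Fin m) (Fin m) ℂ).map C * N *
          (↑P⁻¹ : Matrix (Fin m) (Fin m) ℂ).map C :
            Matrix (Fin m) (Fin m) (MvPolynomial (Fin n × Fin n) ℂ))) i j) := by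
      rw [← key, Matrix.map_apply]
    rw [hentry, hdrop i j hij, map_zero]
  -- (2) the pencil space lies in the `(≥ −r)`-piece of the filtration
  have hgen : ∀ x : Fin n × Fin n → ℂ, N.map (MvPolynomial.eval x) ∈ wtFilt P lvl (-(r : ℤ)) := by
    intro x
    apply Submodule.subset_span
    intro i j hw
    apply hconj_eval x i j
    simp only [wt] at hw
    omega
  have hlow : pencilSpace N ≤ wtFilt P lvl (-(r : ℤ)) := by
    apply Submodule.span_le.2
    rintro M (hM | ⟨v, rfl⟩)
    · rw [Set.mem_singleton_iff] at hM
      rw [hM]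
      exact hgen 0
    · show N.map _ - N.map _ ∈ _
      exact Submodule.sub_mem _ (hgen v) (hgen 0)
  -- (3) the tops of `K` lie in `W ∩ F_{≥ c}`
  obtain ⟨T, hT⟩ := exists_topMap_linPart N hN
  have hmapK : K.map T ≤ pencilSpace N ⊓ wtFilt P lvl c := by
    intro M hM
    rw [Submodule.mem_map] at hM
    obtain ⟨v, hv, rfl⟩ := hM
    rw [hT]
    refine Submodule.mem_inf.2 ⟨Submodule.subset_span (Or.inr ⟨v, rfl⟩), ?_⟩
    apply Submodule.subset_span
    intro i j hw
    apply hK v hv i j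
    simp only [wt] at hw
    omega
  have hW_le : pencilSpace N ≤ Submodule.span ℂ {N.map (MvPolynomial.eval 0)} ⊔ LinearMap.range T := by
    apply Submodule.span_le.2
    rintro M (hM | ⟨v, rfl⟩)
    · exact Submodule.mem_sup_left (Submodule.subset_span hM)
    · apply Submodule.mem_sup_right
      rw [← hT]
      exact LinearMap.mem_range_self T v
  -- (4) dimension bookkeeping
  have hDle : Module.finrank ℂ (pencilSpace N) ≤ 1 + Module.finrank ℂ (LinearMap.range T) := by
    calc Module.finrank ℂ (pencilSpace N)
        ≤ Module.finrank ℂ ↥(Submodule.span ℂ {N.map (MvPolynomial.eval 0)} ⊔ LinearMap.range T) :=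
          Submodule.finrank_mono hW_le
      _ ≤ Module.finrank ℂ (Submodule.span ℂ {N.map (MvPolynomial.eval 0)}) +
            Module.finrank ℂ (LinearMap.range T) :=
          Submodule.finrank_add_le_finrank_add_finrank _ _
      _ ≤ 1 + Module.finrank ℂ (LinearMap.range T) := by
          gcongr
          exact (finrank_span_le_card _).trans (by simp)
  have hRN : Module.finrank ℂ (LinearMap.range T) + Module.finrank ℂ (LinearMap.ker T) = n * n := by
    rw [LinearMap.finrank_range_add_finrank_ker, Module.finrank_fintype_fun_eq_card, Fintype.card_prod,
      Fintype.card_fin]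
  have hRNK : Module.finrank ℂ ↥(K.map T) + Module.finrank ℂ ↥(LinearMap.ker (T.domRestrict K)) =
      Module.finrank ℂ K := by
    rw [← LinearMap.range_domRestrict]
    exact LinearMap.finrank_range_add_finrank_ker _
  have hkerle : Module.finrank ℂ ↥(LinearMap.ker (T.domRestrict K)) ≤ Module.finrank ℂ (LinearMap.ker T) := by
    rw [LinearMap.ker_domRestrict, ← Submodule.finrank_map_subtype_eq K, Submodule.map_comap_subtype]
    exact Submodule.finrank_mono inf_le_right
  have ha : Module.finrank ℂ ↥(K.map T) ≤ Module.finrank ℂ ↥(pencilSpace N ⊓ wtFilt P lvl c) :=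
    Submodule.finrank_mono hmapK
  -- (5) the floor-division budget of G″
  have hF1 : p + r * n ≤ (c + r) * ((p - 1 + r * (n - 1)) / (c + r)) + (c + r) + r := by
    have hq : 0 < c + r := by omega
    have h1 := Nat.div_add_mod (p - 1 + r * (n - 1)) (c + r)
    have h2 := Nat.mod_lt (p - 1 + r * (n - 1)) hq
    have h3 : r * (n - 1) = r * n - r := Nat.mul_sub_one r n
    have h4 : r ≤ r * n := Nat.le_mul_of_pos_right r hn
    rw [h3] at h1 h2 ⊢
    generalize (p - 1 + (r * n - r)) / (c + r) = k at h1 ⊢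
    generalize (p - 1 + (r * n - r)) % (c + r) = md at h1 h2
    generalize r * n = rn at h1 h2 h4 ⊢
    generalize hq' : c + r = q at h1 h2 hq ⊢
    generalize (q * k) = qk at h1 ⊢
    omega
  -- (6) clipping
  have hclip := plDeg_clipping (pencilSpace N) P lvl p r c (by omega) hlow
  refine ⟨P, lvl, p, hlvl, ?_⟩
  -- cast everything to ℤ
  set k := (p - 1 + r * (n - 1)) / (c + r) with hk
  have e1 : ((k + 1) * n : ℤ) < Module.finrank ℂ K := by exact_mod_cast hdim
  have e2 : (Module.finrank ℂ ↥(K.map T) : ℤ) ≤ Module.finrank ℂ ↥(pencilSpace N ⊓ wtFilt P lvl c) := by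
    exact_mod_cast ha
  have e3 : (Module.finrank ℂ ↥(K.map T) : ℤ) + Module.finrank ℂ ↥(LinearMap.ker (T.domRestrict K)) =
      Module.finrank ℂ K := by exact_mod_cast hRNK
  have e4 : (Module.finrank ℂ ↥(LinearMap.ker (T.domRestrict K)) : ℤ) ≤ Module.finrank ℂ (LinearMap.ker T) := by
    exact_mod_cast hkerle
  have e5 : (Module.finrank ℂ (LinearMap.range T) : ℤ) + Module.finrank ℂ (LinearMap.ker T) = n * n := by
    exact_mod_cast hRN
  have e6 : (Module.finrank ℂ (pencilSpace N) : ℤ) ≤ 1 + Module.finrank ℂ (LinearMap.range T) := by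
    exact_mod_cast hDle
  have e7 : ((n : ℤ)) ^ 2 ≤ Module.finrank ℂ (pencilSpace N) + n := by exact_mod_cast htop
  have e8 : (p : ℤ) + r * n ≤ (c + r) * k + (c + r) + r := by exact_mod_cast hF1
  have e9 : (r : ℤ) + c < p := by exact_mod_cast hdeep
  have e10 : (1 : ℤ) ≤ n := by exact_mod_cast hn
  have hc0 : (0 : ℤ) ≤ c := by positivity
  have hr0 : (0 : ℤ) ≤ r := by positivity
  -- product hints
  have P1 := mul_le_mul_of_nonneg_left e2 (add_nonneg hc0 hr0)
  have P2 := mul_le_mul_of_nonneg_left e1.le (add_nonneg hc0 hr0)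
  have P3 := mul_le_mul_of_nonneg_left e8 (by positivity : (0 : ℤ) ≤ n)
  have P4 := mul_le_mul_of_nonneg_left e7 hc0
  have P5 : (1 : ℤ) * n ≤ (p - r - c) * n := mul_le_mul_of_nonneg_right (by linarith) (by positivity)
  have ea : (Module.finrank ℂ K : ℤ) + Module.finrank ℂ (pencilSpace N) - 1 - n * n ≤
      Module.finrank ℂ ↥(pencilSpace N ⊓ wtFilt P lvl c) := by linarith
  have P6 := mul_le_mul_of_nonneg_left ea (add_nonneg hc0 hr0)
  nlinarith [hclip, P1, P2, P3, P4, P5, P6, e3, e4, e5, e6, e7, e8, e9, e10]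

/-- (K1c — REFUTED as typed, v1.7: `not_shallowCertificatesDestabilise` below, by the `Irr₃` pencil `f′ + x₀₀·e` and its
trivial one-level certificate `p = 1, r = 0, c = 1`) shallow certificates: does EVERY uniform weight certificate of a top-heavy
pencil space force `PlUnstable`?  NO.  K1b settles the DEEP range `p > r + c` positively; in the shallow range `p ≤ r + c` the
K1a bound only gives `plDeg ≥ n(p − r − c) ≥ −c·n`, and the certifying flag may be too coarse to carry any instability at all
(`p = 1`: certified iff `codim 𝒯 > n`, i.e. exactly at the top-heavy boundary `dim 𝒯 = n² − n − 1`, `N(0) ∉ 𝒯`), while `W`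
itself can be semistable (`Irr₃`, K2).  A format-restricted / `p ≥ 2` variant is not claimed either way. -/
def ShallowCertificatesDestabilise : Prop :=
  ∀ (n m : ℕ) (N : AffMat n m), IsAffine N → 2 ≤ n →
    ∀ (P : (Matrix (Fin m) (Fin m) ℂ)ˣ) (lvl : Fin m → ℕ) (p r c : ℕ) (K : Submodule ℂ (Fin n × Fin n → ℂ)),
      Certifies N P lvl p r c K → n ^ 2 ≤ Module.finrank ℂ (pencilSpace N) + n → PlUnstable (pencilSpace N)

/-- MOR's `Irr₃ = span{e = E₁₂+E₂₃, f′ = E₂₁−E₃₂}` (✓ `irrThree_nilpotent/irreducible`, p646307; same literals). -/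
def irrE : Matrix (Fin 3) (Fin 3) ℂ := !![0, 1, 0; 0, 0, 1; 0, 0, 0]
def irrF : Matrix (Fin 3) (Fin 3) ℂ := !![0, 0, 0; 1, 0, 0; 0, -1, 0]

def irrThreeSpace : Submodule ℂ (Matrix (Fin 3) (Fin 3) ℂ) := Submodule.span ℂ {irrE, irrF}

/-- The separating invariant: `F(X ∧ Y) = tr([X,Y]²)` is an `SL₃`-invariant quadratic form on `Λ² gl₃` and
`F(e ∧ f′) = tr(diag(1,−2,1)²) = 6 ≠ 0` — so `[Irr₃]` is NOT in the nullcone: **Irr₃ is semistable**, while every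
triangularisable / G-, G′-, G″-certified space is unstable.  (In)stability separates the two worlds of the dossier.
Kernel datum (decidable arithmetic). -/
theorem irrThree_commutator : irrE * irrF - irrF * irrE = !![1, 0, 0; 0, -2, 0; 0, 0, 1] := by
  ext i j
  fin_cases i <;> fin_cases j <;> simp [irrE, irrF]
  norm_num

theorem irrThree_commutator_sq_trace : Matrix.trace ((irrE * irrF - irrF * irrE) ^ 2) = 6 := by
  rw [irrThree_commutator, pow_two, Matrix.trace, Fin.sum_univ_three]
  simp
  norm_num

/-- Extraction: members of `wtFilt P lvl d` have conjugate supported on weights `≥ d`. -/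
theorem conj_apply_eq_zero_of_mem_wtFilt {P : (Matrix (Fin m) (Fin m) ℂ)ˣ} {lvl : Fin m → ℕ} {d : ℤ}
    {M : Matrix (Fin m) (Fin m) ℂ} (hM : M ∈ wtFilt P lvl d) :
    ∀ i j : Fin m, wt lvl i j < d → conj P M i j = 0 := by
  induction hM using Submodule.span_induction with
  | mem x hx => exact hx
  | zero => intro i j _; simp [conj]
  | add x y _ _ hx hy =>
      intro i j h
      have e : conj P (x + y) = conj P x + conj P y := by simp [conj, Matrix.mul_add, Matrix.add_mul]
      rw [e, Matrix.add_apply, hx i j h, hy i j h, add_zero]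
  | smul a x _ hx =>
      intro i j h
      have e : conj P (a • x) = a • conj P x := by simp [conj]
      rw [e, Matrix.smul_apply, hx i j h, smul_zero]

/-- **The weight argument behind semistability witnesses (the HM ⇒ direction for the invariant `tr([X,Y]²)`):**
if `X` has `λ`-weights `≥ d` and `Y` has `λ`-weights `≥ d'` with `d + d' ≥ 1`, then `[X, Y]` is conjugate to a matrix
supported on positive weights, so `tr([X,Y]²) = 0`. -/
theorem trace_comm_sq_eq_zero_of_wt (P : (Matrix (Fin m) (Fin m) ℂ)ˣ) (lvl : Fin m → ℕ) {d d' : ℤ}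
    (hdd : 1 ≤ d + d') {X Y : Matrix (Fin m) (Fin m) ℂ} (hX : X ∈ wtFilt P lvl d) (hY : Y ∈ wtFilt P lvl d') :
    Matrix.trace ((X * Y - Y * X) ^ 2) = 0 := by
  have hX' := conj_apply_eq_zero_of_mem_wtFilt hX
  have hY' := conj_apply_eq_zero_of_mem_wtFilt hY
  set C := conj P X * conj P Y - conj P Y * conj P X with hC
  -- `C` vanishes at every position of weight `≤ 0`
  have hCz : ∀ i j : Fin m, lvl i ≤ lvl j → C i j = 0 := by
    intro i j hij
    have h1 : (conj P X * conj P Y) i j = 0 := by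
      rw [Matrix.mul_apply]
      apply Finset.sum_eq_zero
      intro k _
      by_cases hk : wt lvl i k < d
      · rw [hX' i k hk, zero_mul]
      · rw [hY' k j (by simp only [wt] at hk ⊢; omega), mul_zero]
    have h2 : (conj P Y * conj P X) i j = 0 := by
      rw [Matrix.mul_apply]
      apply Finset.sum_eq_zero
      intro k _
      by_cases hk : wt lvl i k < d'
      · rw [hY' i k hk, zero_mul]
      · rw [hX' k j (by simp only [wt] at hk ⊢; omega), mul_zero]
    simp [hC, Matrix.sub_apply, h1, h2]
  have htrC : Matrix.trace (C ^ 2) = 0 := by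
    rw [pow_two, Matrix.trace]
    apply Finset.sum_eq_zero
    intro i _
    rw [Matrix.diag_apply, Matrix.mul_apply]
    apply Finset.sum_eq_zero
    intro j _
    rcases le_or_gt (lvl i) (lvl j) with hij | hij
    · rw [hCz i j hij, zero_mul]
    · rw [hCz j i hij.le, mul_zero]
  have hconj : conj P ((X * Y - Y * X) ^ 2) = C ^ 2 := by
    rw [pow_two, pow_two, conj_mul, conj_sub, conj_mul, conj_mul]
  rw [← trace_conj P, hconj, htrC]

/-- `dim Irr₃ ≤ 2`. -/
theorem finrank_irrThreeSpace_le : Module.finrank ℂ irrThreeSpace ≤ 2 := by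
  classical
  have h := finrank_span_finset_le_card (R := ℂ) ({irrE, irrF} : Finset (Matrix (Fin 3) (Fin 3) ℂ))
  rw [Finset.coe_pair] at h
  exact h.trans Finset.card_le_two

theorem trace_comm_irrE_sq (y₁ y₂ : ℂ) :
    Matrix.trace ((irrE * (y₁ • irrE + y₂ • irrF) - (y₁ • irrE + y₂ • irrF) * irrE) ^ 2) = 6 * y₂ ^ 2 := by
  have h : irrE * (y₁ • irrE + y₂ • irrF) - (y₁ • irrE + y₂ • irrF) * irrE = y₂ • (irrE * irrF - irrF * irrE) := by
    rw [Matrix.mul_add, Matrix.add_mul, Matrix.mul_smul, Matrix.mul_smul, Matrix.smul_mul, Matrix.smul_mul,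
      smul_sub]
    abel
  rw [h, smul_pow, Matrix.trace_smul, irrThree_commutator_sq_trace, smul_eq_mul]
  ring

theorem trace_comm_irrF_sq (y₁ y₂ : ℂ) :
    Matrix.trace ((irrF * (y₁ • irrE + y₂ • irrF) - (y₁ • irrE + y₂ • irrF) * irrF) ^ 2) = 6 * y₁ ^ 2 := by
  have h : irrF * (y₁ • irrE + y₂ • irrF) - (y₁ • irrE + y₂ • irrF) * irrF = -(y₁ • (irrE * irrF - irrF * irrE)) := by
    rw [Matrix.mul_add, Matrix.add_mul, Matrix.mul_smul, Matrix.mul_smul, Matrix.smul_mul, Matrix.smul_mul,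
      smul_sub]
    abel
  rw [h, neg_sq, smul_pow, Matrix.trace_smul, irrThree_commutator_sq_trace, smul_eq_mul]
  ring

/-- Key step: if all of `Irr₃` has weights `≥ d`, then no nonzero element of `Irr₃` has weights `≥ d'` when `d + d' ≥ 1`
(else `tr([e,Y]²) = 6y₂²` and `tr([f′,Y]²) = 6y₁²` would vanish). -/
theorem irrThree_eq_zero_of_wt {P : (Matrix (Fin 3) (Fin 3) ℂ)ˣ} {lvl : Fin 3 → ℕ} {d d' : ℤ} (hdd : 1 ≤ d + d')
    (hW : irrThreeSpace ≤ wtFilt P lvl d) {Y : Matrix (Fin 3) (Fin 3) ℂ} (hY : Y ∈ irrThreeSpace)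
    (hYF : Y ∈ wtFilt P lvl d') : Y = 0 := by
  have he : irrE ∈ wtFilt P lvl d := hW (Submodule.subset_span (by simp))
  have hf : irrF ∈ wtFilt P lvl d := hW (Submodule.subset_span (by simp))
  obtain ⟨y₁, y₂, rfl⟩ := Submodule.mem_span_pair.1 hY
  have t1 := trace_comm_sq_eq_zero_of_wt P lvl hdd he hYF
  have t2 := trace_comm_sq_eq_zero_of_wt P lvl hdd hf hYF
  rw [trace_comm_irrE_sq] at t1
  rw [trace_comm_irrF_sq] at t2
  have hy₂ : y₂ = 0 := by simpa using t1
  have hy₁ : y₁ = 0 := by simpa using t2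
  simp [hy₁, hy₂]

/-- **K2 (PROVED v1.5): MOR's `Irr₃` is Plücker-SEMISTABLE** — no cocharacter has positive Plücker degree on it.
Proof: pair the filtration steps `d ↔ 1 − d`; `dim(W ∩ F_d) + dim(W ∩ F_{1−d}) ≤ dim W` for every `d` by
`irrThree_eq_zero_of_wt` (the invariant `tr([X,Y]²)`), and the paired sum is exactly `plDeg`. -/
theorem irrThree_semistable : ¬ PlUnstable irrThreeSpace := by
  classical
  rintro ⟨P, lvl, p, -, hpos⟩
  have hD2 : (Module.finrank ℂ irrThreeSpace : ℤ) ≤ 2 := by exact_mod_cast finrank_irrThreeSpace_le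
  set W := irrThreeSpace with hWdef
  set f : ℤ → ℤ := fun d => (Module.finrank ℂ ↥(W ⊓ wtFilt P lvl d) : ℤ) with hf
  set D : ℤ := (Module.finrank ℂ W : ℤ) with hD
  have f_le : ∀ d, f d ≤ D := by
    intro d; simp only [hf, hD]
    exact_mod_cast Submodule.finrank_mono (inf_le_left : W ⊓ wtFilt P lvl d ≤ W)
  have f_nn : ∀ d, 0 ≤ f d := fun d => by simp only [hf]; positivity
  -- full rank at `d` forces `W ≤ F_d`
  have full : ∀ d, f d = D → W ≤ wtFilt P lvl d := by
    intro d h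
    have h' : Module.finrank ℂ ↥(W ⊓ wtFilt P lvl d) = Module.finrank ℂ W := by
      simp only [hf, hD] at h; exact_mod_cast h
    have := Submodule.eq_of_le_of_finrank_eq (inf_le_left : W ⊓ wtFilt P lvl d ≤ W) h'
    exact inf_eq_left.1 this
  -- the vanishing lemma empties the opposite piece
  have empty : ∀ d d' : ℤ, 1 ≤ d + d' → W ≤ wtFilt P lvl d → f d' = 0 := by
    intro d d' hdd hle
    have hbot : W ⊓ wtFilt P lvl d' = ⊥ := by
      rw [eq_bot_iff]
      intro Y hY
      rw [Submodule.mem_bot]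
      exact irrThree_eq_zero_of_wt hdd hle (Submodule.mem_inf.1 hY).1 (Submodule.mem_inf.1 hY).2
    show (Module.finrank ℂ ↥(W ⊓ wtFilt P lvl d') : ℤ) = 0
    rw [hbot, finrank_bot, Nat.cast_zero]
  have key : ∀ d : ℤ, f d + f (1 - d) ≤ D := by
    intro d
    by_cases h1 : f d = D
    · have := empty d (1 - d) (by omega) (full d h1); rw [this, add_zero]; exact f_le d
    by_cases h2 : f (1 - d) = D
    · have := empty (1 - d) d (by omega) (full (1 - d) h2); rw [this, zero_add]; exact f_le (1 - d)
    have a1 : f d ≤ D - 1 := by have := f_le d; omega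
    have a2 : f (1 - d) ≤ D - 1 := by have := f_le (1 - d); omega
    have := f_nn d
    have := f_nn (1 - d)
    omega
  -- plDeg = Σ_{d=1}^{p} (f d + f (1-d) - D) ≤ 0
  have hre : ∑ d ∈ Finset.Icc (1 - (p : ℤ)) 0, (D - f d) = ∑ d ∈ Finset.Icc (1 : ℤ) p, (D - f (1 - d)) := by
    apply Finset.sum_nbij' (fun d => 1 - d) (fun d => 1 - d)
    · intro a ha; simp only [Finset.mem_Icc] at ha ⊢; omega
    · intro a ha; simp only [Finset.mem_Icc] at ha ⊢; omega
    · intro a _; ring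
    · intro a _; ring
    · intro a _; simp
  have hle : plDeg W P lvl p ≤ 0 := by
    have : plDeg W P lvl p = ∑ d ∈ Finset.Icc (1 : ℤ) p, (f d + f (1 - d) - D) := by
      simp only [plDeg]
      rw [show (∑ d ∈ Finset.Icc (1 - (p : ℤ)) 0,
          ((Module.finrank ℂ W : ℤ) - (Module.finrank ℂ ↥(W ⊓ wtFilt P lvl d) : ℤ))) =
          ∑ d ∈ Finset.Icc (1 - (p : ℤ)) 0, (D - f d) from rfl, hre, ← Finset.sum_sub_distrib]
      apply Finset.sum_congr rfl
      intro d _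
      simp only [hf, hD]
      ring
    rw [this]
    apply Finset.sum_nonpos
    intro d _
    have := key d
    linarith
  exact absurd hpos (not_lt.2 hle)

/-! ### K1c is FALSE as typed (v1.7): the trivial one-level certificate of the `Irr₃` pencil
`N(x) = f′ + x₀₀·e` (`n = 2`, `m = 3`): top space `ℂ·e` has codimension `n + 1 = 3` in `ℂ^{n×n}`, so `p = 1, r = 0, c = 1`,
`K = {x₀₀ = 0}` (`dim K = 3 > (0 + 1)·n = 2`) certifies it (G″ ⇒ flag-cheap), it is top-heavy (`n² = 4 ≤ dim W + n`,
`W = Irr₃`), and `W` is Plücker-SEMISTABLE (K2).  Moral: shallow certificates include flags too coarse to carry any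
instability; the clipping mechanism (K1a/K1b) is exactly the deep regime `p > r + c`. -/

/-- The `Irr₃` affine pencil `f′ + x₀₀ • e` over `2 × 2` parameters. -/
def irrPencil : AffMat 2 3 := irrF.map C + (X ((0 : Fin 2), (0 : Fin 2)) : MvPolynomial (Fin 2 × Fin 2) ℂ) • irrE.map C

theorem irrPencil_isAffine : IsAffine irrPencil := by
  intro i j
  simp only [irrPencil, Matrix.add_apply, Matrix.smul_apply, Matrix.map_apply, smul_eq_mul]
  refine (totalDegree_add _ _).trans (max_le (by simp [totalDegree_C]) ?_)
  refine (totalDegree_mul _ _).trans ?_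
  simp [totalDegree_X, totalDegree_C]

theorem irrPencil_eval (v : Fin 2 × Fin 2 → ℂ) : irrPencil.map (MvPolynomial.eval v) = irrF + v (0, 0) • irrE := by
  ext i j
  simp [irrPencil, Matrix.map_apply]

theorem linPart_irrPencil (v : Fin 2 × Fin 2 → ℂ) : linPart irrPencil v = v (0, 0) • irrE := by
  simp only [linPart, irrPencil_eval]
  ext i j
  simp

theorem pencilSpace_irrPencil : pencilSpace irrPencil = irrThreeSpace := by
  apply le_antisymm
  · refine Submodule.span_le.2 ?_
    rintro M (hM | ⟨v, rfl⟩)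
    · rw [Set.mem_singleton_iff] at hM
      subst hM
      rw [irrPencil_eval]
      simp only [Pi.zero_apply, zero_smul, add_zero]
      exact Submodule.subset_span (by simp)
    · rw [linPart_irrPencil]
      exact Submodule.smul_mem _ _ (Submodule.subset_span (by simp))
  · refine Submodule.span_le.2 ?_
    rintro M (rfl | rfl)
    · -- `e = linPart N (indicator of (0,0))`
      have h : linPart irrPencil (fun k => if k = ((0 : Fin 2), (0 : Fin 2)) then 1 else 0) = irrE := by
        rw [linPart_irrPencil]; simp
      rw [← h]
      exact Submodule.subset_span (Or.inr ⟨_, rfl⟩)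
    · -- `f′ = N(0)`
      have h : irrPencil.map (MvPolynomial.eval 0) = irrF := by rw [irrPencil_eval]; simp
      rw [← h]
      exact Submodule.subset_span (Or.inl rfl)

theorem linearIndependent_irrEF : LinearIndependent ℂ ![irrE, irrF] := by
  rw [LinearIndependent.pair_iff]
  intro s t h
  have h01 := congrFun (congrFun h 0) 1
  have h10 := congrFun (congrFun h 1) 0
  simp [irrE, irrF] at h01 h10
  exact ⟨h01, h10⟩

theorem finrank_irrThreeSpace : Module.finrank ℂ irrThreeSpace = 2 := by
  have h := finrank_span_eq_card linearIndependent_irrEF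
  have hr : Set.range ![irrE, irrF] = {irrE, irrF} := by
    rw [show ({irrE, irrF} : Set (Matrix (Fin 3) (Fin 3) ℂ)) = {irrF, irrE} from Set.pair_comm _ _]
    simp [Matrix.range_cons, Matrix.range_empty]
  rw [hr, Fintype.card_fin] at h
  exact h

/-- The parameter space `K = {x₀₀ = 0}` of the trivial certificate. -/
def projK : (Fin 2 × Fin 2 → ℂ) →ₗ[ℂ] ℂ := LinearMap.proj ((0 : Fin 2), (0 : Fin 2))

def kerK : Submodule ℂ (Fin 2 × Fin 2 → ℂ) := LinearMap.ker projK

theorem finrank_kerK : Module.finrank ℂ kerK = 3 := by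
  have h := LinearMap.finrank_range_add_finrank_ker projK
  have hr : LinearMap.range projK = ⊤ := LinearMap.range_eq_top.2 (LinearMap.proj_surjective _)
  rw [hr, finrank_top, Module.finrank_self, Module.finrank_fintype_fun_eq_card] at h
  simp only [Fintype.card_prod, Fintype.card_fin] at h
  unfold kerK
  omega

theorem irrPencil_certifies : Certifies irrPencil 1 (fun _ => 0) 1 0 1 kerK := by
  refine ⟨le_rfl, fun _ => Nat.zero_lt_one, ?_, ?_, ?_⟩
  · intro i j hij
    simp at hij
  · intro v hv i j _
    have hv0 : v (0, 0) = 0 := by simpa [kerK, projK] using hv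
    rw [linPart_irrPencil, hv0, zero_smul]
    simp [conj]
  · rw [finrank_kerK]
    norm_num

/-- **K1c REFUTED (v1.7).** -/
theorem not_shallowCertificatesDestabilise : ¬ ShallowCertificatesDestabilise := by
  intro h
  have htop : 2 ^ 2 ≤ Module.finrank ℂ (pencilSpace irrPencil) + 2 := by
    rw [pencilSpace_irrPencil, finrank_irrThreeSpace]; norm_num
  have hu := h 2 3 irrPencil irrPencil_isAffine le_rfl 1 (fun _ => 0) 1 0 1 kerK irrPencil_certifies htop
  rw [pencilSpace_irrPencil] at hu
  exact irrThree_semistable hu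

/-- **SG — SEMISTABLE-GAP conjecture** («balanced Gerstenhaber»): a Plücker-semistable linear space of nilpotent
`m × m` matrices has dimension `O(m)` (sharp guess below: `≤ m − 1`, attained by `Irr₃`, `Irr(4,3)`?).  Every nilpotent
space of dimension `≫ m` — in particular every top-heavy `W` of a format `C₀m² < n³` (`dim W ≥ n² − n ≥ m^{4/3}`) — is
then UNSTABLE and carries Kempf's canonical optimal weighted flag although it has no invariant subspace. -/
def SemistableGap : Prop :=
  ∃ γ : ℕ, ∀ (m : ℕ) (W : Submodule ℂ (Matrix (Fin m) (Fin m) ℂ)), IsNilSpace W → ¬ PlUnstable W →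
    Module.finrank ℂ W ≤ γ * m

/-- Sharp form of SG (guess; cheapest falsifier = a semistable nilpotent `d`-plane in `M₄` with `d ≥ 4`). -/
def SemistableGapSharp : Prop :=
  ∀ (m : ℕ) (W : Submodule ℂ (Matrix (Fin m) (Fin m) ℂ)), IsNilSpace W → ¬ PlUnstable W →
    Module.finrank ℂ W + 1 ≤ m

/-- **FIRST LEMMA of `pluecker-gap`**: SG puts every top-heavy nilpotent space of a format `C₀m² < n³` in the
nullcone (arithmetic: `γ·m ≤ γ·n^{3/2} < n² − n` for `n ≥ n₀`). -/
theorem topHeavy_unstable (hSG : SemistableGap) :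
    ∃ n₀ : ℕ, ∀ n ≥ n₀, ∀ (m : ℕ), m ^ 2 < n ^ 3 → ∀ W : Submodule ℂ (Matrix (Fin m) (Fin m) ℂ),
      IsNilSpace W → n ^ 2 ≤ Module.finrank ℂ W + n → PlUnstable W := by
  obtain ⟨γ, hγ⟩ := hSG
  refine ⟨γ ^ 2 + 2, fun n hn m hm W hnil htop => ?_⟩
  by_contra hst
  have hD := hγ m W hnil hst
  have h1 : (n : ℤ) ^ 2 ≤ (Module.finrank ℂ W : ℤ) + n := by exact_mod_cast htop
  have h2 : (Module.finrank ℂ W : ℤ) ≤ γ * m := by exact_mod_cast hD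
  have h3 : (m : ℤ) ^ 2 < (n : ℤ) ^ 3 := by exact_mod_cast hm
  have h4 : (γ : ℤ) ^ 2 + 2 ≤ n := by exact_mod_cast hn
  have hn0 : (0 : ℤ) ≤ n := by positivity
  have hγ0 : (0 : ℤ) ≤ γ := by positivity
  have hm0 : (0 : ℤ) ≤ m := by positivity
  have h5 : (n : ℤ) ^ 2 - n ≤ γ * m := by linarith
  have h5' : (0 : ℤ) ≤ (n : ℤ) ^ 2 - n := by nlinarith
  have h6 : ((n : ℤ) ^ 2 - n) ^ 2 ≤ ((γ : ℤ) * m) ^ 2 := by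
    exact pow_le_pow_left₀ h5' h5 2
  have h7 : ((γ : ℤ) * m) ^ 2 ≤ (γ : ℤ) ^ 2 * n ^ 3 := by
    have : (γ : ℤ) ^ 2 * m ^ 2 ≤ (γ : ℤ) ^ 2 * n ^ 3 :=
      mul_le_mul_of_nonneg_left h3.le (by positivity)
    nlinarith
  have h8 : ((n : ℤ) ^ 2 - n) ^ 2 = (n : ℤ) ^ 2 * ((n - 1) ^ 2) := by ring
  have h9 : (1 : ℤ) ≤ (n - 1) ^ 2 - γ ^ 2 * n := by
    have : (0 : ℤ) ≤ n * (n - 2 - γ ^ 2) := mul_nonneg hn0 (by linarith)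
    nlinarith
  have h10 : (n : ℤ) ^ 2 * ((n - 1) ^ 2 - γ ^ 2 * n) ≤ 0 := by nlinarith
  have h11 : (4 : ℤ) ≤ (n : ℤ) ^ 2 := by nlinarith
  nlinarith


/-! ## Appendix (v1.8): L1 DECOMPOSITION — the `gr`-limit of a subspace (HOME/CLOSEDNESS.md § «L1 made elementary»)
The symmetric-certificate lemma (v ≤ 1.7: `stub_gradedCertificate`) reduced to finite-dimensional linear algebra: proved glue `L1_*` + four `stub_*`
(the three `stub_*` are sorried; everything else proved, incl. (G3') `L1_grIncidence`), composition `gradedCertificate` kernel-checked. -/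

section L1Decomposition

theorem conj_add (P : (Matrix (Fin m) (Fin m) ℂ)ˣ) (X Y : Matrix (Fin m) (Fin m) ℂ) :
    conj P (X + Y) = conj P X + conj P Y := by
  simp [conj, Matrix.mul_add, Matrix.add_mul]

theorem conj_smul (P : (Matrix (Fin m) (Fin m) ℂ)ˣ) (a : ℂ) (X : Matrix (Fin m) (Fin m) ℂ) :
    conj P (a • X) = a • conj P X := by
  simp [conj]

theorem conj_zero (P : (Matrix (Fin m) (Fin m) ℂ)ˣ) : conj P 0 = 0 := by simp [conj]

theorem wtComp_add (lvl : Fin m → ℕ) (d : ℤ) (A B : Matrix (Fin m) (Fin m) ℂ) :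
    wtComp lvl d (A + B) = wtComp lvl d A + wtComp lvl d B := by
  ext i j; simp only [wtComp, Matrix.of_apply, Matrix.add_apply]; split_ifs <;> simp

theorem wtComp_smul (lvl : Fin m → ℕ) (d : ℤ) (a : ℂ) (A : Matrix (Fin m) (Fin m) ℂ) :
    wtComp lvl d (a • A) = a • wtComp lvl d A := by
  ext i j; simp only [wtComp, Matrix.of_apply, Matrix.smul_apply, smul_eq_mul]; split_ifs <;> simp

/-- The weight-`d` projector `M ↦ P⁻¹ (P M P⁻¹)_d P` of `gl_m` (ad-grading of the cocharacter `(P, lvl)`). -/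
def wtProjM (P : (Matrix (Fin m) (Fin m) ℂ)ˣ) (lvl : Fin m → ℕ) (d : ℤ) :
    Matrix (Fin m) (Fin m) ℂ →ₗ[ℂ] Matrix (Fin m) (Fin m) ℂ where
  toFun M := conj P⁻¹ (wtComp lvl d (conj P M))
  map_add' X Y := by rw [conj_add, wtComp_add, conj_add]
  map_smul' a X := by rw [conj_smul, wtComp_smul, conj_smul]; rfl

@[simp] theorem wtProjM_apply (P : (Matrix (Fin m) (Fin m) ℂ)ˣ) (lvl : Fin m → ℕ) (d : ℤ) (M : Matrix (Fin m) (Fin m) ℂ) :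
    wtProjM P lvl d M = conj P⁻¹ (wtComp lvl d (conj P M)) := rfl

/-- The coordinate flag of a frame, indexed by `ℤ`: vectors whose `P`-coordinates vanish at all levels `< ℓ`
(`ℓ ≤ 0`: `⊤`; `ℓ ≥ p > lvl`: `⊥`).  For the GRADING frame `(P, lvl)` this is `V_{≥ℓ}`. -/
def flagSub (P : (Matrix (Fin m) (Fin m) ℂ)ˣ) (lvl : Fin m → ℕ) (ℓ : ℤ) : Submodule ℂ (Fin m → ℂ) where
  carrier := {v | ∀ i, (lvl i : ℤ) < ℓ → ((P : Matrix (Fin m) (Fin m) ℂ) *ᵥ v) i = 0}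
  add_mem' {a b} ha hb := by
    intro i hi
    simp [Matrix.mulVec_add, ha i hi, hb i hi]
  zero_mem' := by intro i hi; simp
  smul_mem' c {a} ha := by
    intro i hi
    simp [Matrix.mulVec_smul, ha i hi]

theorem mem_flagSub {P : (Matrix (Fin m) (Fin m) ℂ)ˣ} {lvl : Fin m → ℕ} {ℓ : ℤ} {v : Fin m → ℂ} :
    v ∈ flagSub P lvl ℓ ↔ ∀ i, (lvl i : ℤ) < ℓ → ((P : Matrix (Fin m) (Fin m) ℂ) *ᵥ v) i = 0 := Iff.rfl

/-- The weight-`a` projector of `V = ℂ^m` for the cocharacter `(P, lvl)`: `v ↦ P⁻¹ 1_{lvl = a} P v`. -/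
def wtProjV (P : (Matrix (Fin m) (Fin m) ℂ)ˣ) (lvl : Fin m → ℕ) (a : ℤ) : (Fin m → ℂ) →ₗ[ℂ] (Fin m → ℂ) :=
  Matrix.toLin' (conj P⁻¹ (Matrix.diagonal fun i => if (lvl i : ℤ) = a then (1 : ℂ) else 0))

/-- `gr U := ⊕_a pr_a (U ∩ V_{≥a})` — the limit of `U` under the cocharacter `(P, lvl)`. -/
def grSub (P : (Matrix (Fin m) (Fin m) ℂ)ˣ) (lvl : Fin m → ℕ) (U : Submodule ℂ (Fin m → ℂ)) :
    Submodule ℂ (Fin m → ℂ) :=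
  ⨆ a : ℤ, (U ⊓ flagSub P lvl a).map (wtProjV P lvl a)

/-- The same on `gl_m` with the ad-grading: `gr 𝒞 := ⊕_d pr_d (𝒞 ∩ gl_{≥d})` (`gl_{≥d} = wtFilt`). -/
def grMat (P : (Matrix (Fin m) (Fin m) ℂ)ˣ) (lvl : Fin m → ℕ) (𝒞 : Submodule ℂ (Matrix (Fin m) (Fin m) ℂ)) :
    Submodule ℂ (Matrix (Fin m) (Fin m) ℂ) :=
  ⨆ d : ℤ, (𝒞 ⊓ wtFilt P lvl d).map (wtProjM P lvl d)

/-- Entrywise shift condition in a frame: `X` moves level `ℓ` into levels `≥ ℓ + e` (`e = c`: climbs `c`;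
`e = −r`: drops at most `r`) — the shape of `hK` / `hdrop` in `Certifies`. -/
def Shifts (P : (Matrix (Fin m) (Fin m) ℂ)ˣ) (lvl : Fin m → ℕ) (e : ℤ) (X : Matrix (Fin m) (Fin m) ℂ) : Prop :=
  ∀ i j : Fin m, (lvl i : ℤ) < lvl j + e → conj P X i j = 0

/-- Matrices obeying a shift condition form a subspace. -/
def shiftSub (P : (Matrix (Fin m) (Fin m) ℂ)ˣ) (lvl : Fin m → ℕ) (e : ℤ) : Submodule ℂ (Matrix (Fin m) (Fin m) ℂ) where
  carrier := {X | Shifts P lvl e X}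
  add_mem' {X Y} hX hY := by
    intro i j h
    rw [conj_add, Matrix.add_apply, hX i j h, hY i j h, add_zero]
  zero_mem' := by intro i j _; simp [conj_zero]
  smul_mem' a {X} hX := by
    intro i j h
    rw [conj_smul, Matrix.smul_apply, hX i j h, smul_zero]

theorem mem_shiftSub {P : (Matrix (Fin m) (Fin m) ℂ)ˣ} {lvl : Fin m → ℕ} {e : ℤ} {X : Matrix (Fin m) (Fin m) ℂ} :
    X ∈ shiftSub P lvl e ↔ Shifts P lvl e X := Iff.rfl

theorem wtComp_idem (lvl : Fin m → ℕ) (d : ℤ) (A : Matrix (Fin m) (Fin m) ℂ) :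
    wtComp lvl d (wtComp lvl d A) = wtComp lvl d A := by
  ext i j; simp only [wtComp, Matrix.of_apply]; split_ifs <;> rfl

theorem wtComp_supported (lvl : Fin m → ℕ) (d : ℤ) (A : Matrix (Fin m) (Fin m) ℂ) (i j : Fin m) (h : wt lvl i j < d) :
    wtComp lvl d A i j = 0 := by
  simp only [wtComp, Matrix.of_apply]
  rw [if_neg (by omega)]

/-- the finitely many weights / levels that occur -/
def wtRange (lvl : Fin m → ℕ) : Finset ℤ := Finset.image (fun ij : Fin m × Fin m => wt lvl ij.1 ij.2) Finset.univ
def lvlRange (lvl : Fin m → ℕ) : Finset ℤ := Finset.image (fun i : Fin m => (lvl i : ℤ)) Finset.univ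

theorem sum_wtComp (lvl : Fin m → ℕ) (A : Matrix (Fin m) (Fin m) ℂ) : ∑ d ∈ wtRange lvl, wtComp lvl d A = A := by
  ext i j
  rw [Matrix.sum_apply]
  simp only [wtComp, Matrix.of_apply]
  have hm : wt lvl i j ∈ wtRange lvl := Finset.mem_image.2 ⟨(i, j), Finset.mem_univ _, rfl⟩
  rw [Finset.sum_ite_eq, if_pos hm]

theorem conj_sum (Q : (Matrix (Fin m) (Fin m) ℂ)ˣ) (s : Finset ℤ) (f : ℤ → Matrix (Fin m) (Fin m) ℂ) :
    conj Q (∑ d ∈ s, f d) = ∑ d ∈ s, conj Q (f d) := by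
  simp only [conj, Finset.mul_sum, Finset.sum_mul]

theorem sum_wtProjM (P : (Matrix (Fin m) (Fin m) ℂ)ˣ) (lvl : Fin m → ℕ) (X : Matrix (Fin m) (Fin m) ℂ) :
    ∑ d ∈ wtRange lvl, wtProjM P lvl d X = X := by
  simp only [wtProjM_apply]
  have h : ∑ d ∈ wtRange lvl, conj P⁻¹ (wtComp lvl d (conj P X)) =
      conj P⁻¹ (∑ d ∈ wtRange lvl, wtComp lvl d (conj P X)) := (conj_sum _ _ _).symm
  rw [h, sum_wtComp, conj_inv_conj]

/-- the weight-`a` diagonal idempotent in the frame -/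
def wtDiag (lvl : Fin m → ℕ) (a : ℤ) : Matrix (Fin m) (Fin m) ℂ :=
  Matrix.diagonal fun i => if (lvl i : ℤ) = a then (1 : ℂ) else 0

theorem wtDiag_mul (lvl : Fin m → ℕ) (a b : ℤ) :
    wtDiag lvl a * wtDiag lvl b = if a = b then wtDiag lvl a else 0 := by
  unfold wtDiag
  rw [Matrix.diagonal_mul_diagonal]
  split_ifs with hab
  · subst hab
    congr 1; funext i; split_ifs <;> simp
  · rw [← Matrix.diagonal_zero]
    congr 1; funext i
    by_cases h1 : (lvl i : ℤ) = a
    · rw [if_pos h1, if_neg (fun h2 => hab (h1.symm.trans h2)), mul_zero]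
    · rw [if_neg h1, zero_mul]

theorem sum_wtDiag (lvl : Fin m → ℕ) : ∑ a ∈ lvlRange lvl, wtDiag lvl a = 1 := by
  ext i j
  rw [Matrix.sum_apply]
  by_cases hij : i = j
  · subst hij
    simp only [wtDiag, Matrix.diagonal_apply_eq, Matrix.one_apply_eq]
    have hm : (lvl i : ℤ) ∈ lvlRange lvl := Finset.mem_image.2 ⟨i, Finset.mem_univ _, rfl⟩
    rw [Finset.sum_ite_eq, if_pos hm]
  · simp [wtDiag, Matrix.diagonal_apply_ne _ hij, Matrix.one_apply_ne hij]

theorem wtProjV_apply (P : (Matrix (Fin m) (Fin m) ℂ)ˣ) (lvl : Fin m → ℕ) (a : ℤ) (v : Fin m → ℂ) :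
    wtProjV P lvl a v = (↑P⁻¹ : Matrix (Fin m) (Fin m) ℂ) *ᵥ (wtDiag lvl a *ᵥ ((P : Matrix (Fin m) (Fin m) ℂ) *ᵥ v)) := by
  simp only [wtProjV, wtDiag, Matrix.toLin'_apply, conj, inv_inv, Matrix.mulVec_mulVec, Matrix.mul_assoc]

theorem P_mulVec_wtProjV (P : (Matrix (Fin m) (Fin m) ℂ)ˣ) (lvl : Fin m → ℕ) (a : ℤ) (v : Fin m → ℂ) :
    (P : Matrix (Fin m) (Fin m) ℂ) *ᵥ wtProjV P lvl a v = wtDiag lvl a *ᵥ ((P : Matrix (Fin m) (Fin m) ℂ) *ᵥ v) := by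
  rw [wtProjV_apply, Matrix.mulVec_mulVec, Units.mul_inv, Matrix.one_mulVec]

theorem sum_wtProjV (P : (Matrix (Fin m) (Fin m) ℂ)ˣ) (lvl : Fin m → ℕ) (v : Fin m → ℂ) :
    ∑ a ∈ lvlRange lvl, wtProjV P lvl a v = v := by
  simp only [wtProjV_apply]
  rw [← Matrix.mulVec_sum, ← Matrix.sum_mulVec, sum_wtDiag, Matrix.one_mulVec, Matrix.mulVec_mulVec, Units.inv_mul,
    Matrix.one_mulVec]

theorem wtProjV_wtProjV (P : (Matrix (Fin m) (Fin m) ℂ)ˣ) (lvl : Fin m → ℕ) (a b : ℤ) (v : Fin m → ℂ) :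
    wtProjV P lvl a (wtProjV P lvl b v) = if a = b then wtProjV P lvl b v else 0 := by
  rw [wtProjV_apply, P_mulVec_wtProjV, Matrix.mulVec_mulVec _ (wtDiag lvl a) (wtDiag lvl b), wtDiag_mul]
  split_ifs with hab
  · subst hab; rw [wtProjV_apply]
  · rw [Matrix.zero_mulVec, Matrix.mulVec_zero]

theorem wtProjV_mem_flagSub (P : (Matrix (Fin m) (Fin m) ℂ)ˣ) (lvl : Fin m → ℕ) (a : ℤ) (v : Fin m → ℂ) :
    wtProjV P lvl a v ∈ flagSub P lvl a := by
  intro i hi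
  rw [P_mulVec_wtProjV, wtDiag, Matrix.mulVec_diagonal, if_neg (by omega), zero_mul]

/-- abstract `gr`-rank theorem: for orthogonal idempotents `π a` (`a ∈ ℤ`) summing to `id` over `a₀ + [0, L)` and vanishing
outside, and the filtration `F a = ⋂_{b<a} ker (π b)`, one has `finrank (⨆ a, π_a (U ∩ F a)) = finrank U`. -/
theorem finrank_gr_abstract {V : Type*} [AddCommGroup V] [Module ℂ V] [FiniteDimensional ℂ V]
    (π : ℤ → V →ₗ[ℂ] V) (a₀ : ℤ) (L : ℕ)
    (horth : ∀ a b (v : V), π a (π b v) = if a = b then π b v else 0)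
    (hsum : ∀ v : V, ∑ i ∈ Finset.range L, π (a₀ + i) v = v)
    (hvan : ∀ a : ℤ, (a < a₀ ∨ a₀ + L ≤ a) → π a = 0)
    (F : ℤ → Submodule ℂ V) (hF : ∀ a (v : V), v ∈ F a ↔ ∀ b < a, π b v = 0)
    (U : Submodule ℂ V) :
    Module.finrank ℂ ↥(⨆ a : ℤ, (U ⊓ F a).map (π a)) = Module.finrank ℂ U := by
  -- Step 1: rank–nullity per level
  have hFsucc : ∀ a : ℤ, F (a + 1) = F a ⊓ LinearMap.ker (π a) := by
    intro a; ext v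
    simp only [Submodule.mem_inf, LinearMap.mem_ker, hF]
    constructor
    · intro h; exact ⟨fun b hb => h b (by omega), h a (by omega)⟩
    · rintro ⟨h1, h2⟩ b hb
      rcases lt_or_eq_of_le (Int.lt_add_one_iff.1 hb) with hb' | rfl
      · exact h1 b hb'
      · exact h2
  have step1 : ∀ a : ℤ, Module.finrank ℂ ↥(U ⊓ F a) =
      Module.finrank ℂ ↥((U ⊓ F a).map (π a)) + Module.finrank ℂ ↥(U ⊓ F (a + 1)) := by
    intro a
    have h := LinearMap.finrank_range_add_finrank_ker ((π a).domRestrict (U ⊓ F a))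
    rw [LinearMap.range_domRestrict, LinearMap.ker_domRestrict] at h
    have h2 : Module.finrank ℂ ↥((LinearMap.ker (π a)).comap (U ⊓ F a).subtype) =
        Module.finrank ℂ ↥(U ⊓ F (a + 1)) := by
      rw [← Submodule.finrank_map_subtype_eq (U ⊓ F a), Submodule.map_comap_subtype, hFsucc, inf_assoc]
    omega
  have hMfix : ∀ a, ∀ v ∈ (U ⊓ F a).map (π a), π a v = v := by
    intro a v hv
    obtain ⟨u, -, rfl⟩ := Submodule.mem_map.1 hv
    rw [horth, if_pos rfl]
  have hMkill : ∀ a b, a ≠ b → ∀ v ∈ (U ⊓ F b).map (π b), π a v = 0 := by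
    intro a b hab v hv
    obtain ⟨u, -, rfl⟩ := Submodule.mem_map.1 hv
    rw [horth, if_neg hab]
  -- Step 2: disjoint sups, induction on the number of levels
  have step2 : ∀ k : ℕ, Module.finrank ℂ ↥(⨆ i ∈ Finset.range k, (U ⊓ F (a₀ + i)).map (π (a₀ + i))) +
      Module.finrank ℂ ↥(U ⊓ F (a₀ + k)) = Module.finrank ℂ U := by
    intro k
    induction k with
    | zero =>
      have hF0 : F a₀ = ⊤ := by
        refine eq_top_iff.2 fun v _ => (hF a₀ v).2 fun b hb => ?_
        rw [hvan b (Or.inl hb), LinearMap.zero_apply]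
      have h1 : (⨆ i ∈ Finset.range 0, (U ⊓ F (a₀ + i)).map (π (a₀ + i))) = ⊥ := by
        rw [eq_bot_iff]; exact iSup₂_le fun i hi => by simp at hi
      rw [h1, finrank_bot, zero_add, Nat.cast_zero, add_zero, hF0, inf_top_eq]
    | succ k ih =>
      rw [Finset.range_add_one, Finset.iSup_insert]
      have hdisj : (U ⊓ F (a₀ + k)).map (π (a₀ + k)) ⊓
          (⨆ i ∈ Finset.range k, (U ⊓ F (a₀ + i)).map (π (a₀ + i))) = ⊥ := by
        refine eq_bot_iff.2 fun v hv => ?_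
        obtain ⟨hv1, hv2⟩ := Submodule.mem_inf.1 hv
        have hker : (⨆ i ∈ Finset.range k, (U ⊓ F (a₀ + i)).map (π (a₀ + i))) ≤ LinearMap.ker (π (a₀ + k)) :=
          iSup₂_le fun i hi w hw => LinearMap.mem_ker.2
            (hMkill _ _ (by have := Finset.mem_range.1 hi; omega) w hw)
        have h0 := LinearMap.mem_ker.1 (hker hv2)
        rw [hMfix _ v hv1] at h0
        rw [Submodule.mem_bot]; exact h0
      have hsup := Submodule.finrank_sup_add_finrank_inf_eq ((U ⊓ F (a₀ + k)).map (π (a₀ + k)))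
        (⨆ i ∈ Finset.range k, (U ⊓ F (a₀ + i)).map (π (a₀ + i)))
      rw [hdisj, finrank_bot, add_zero] at hsup
      have h1 := step1 (a₀ + k)
      have e : a₀ + (k : ℤ) + 1 = a₀ + ((k + 1 : ℕ) : ℤ) := by push_cast; ring
      rw [e] at h1
      omega
  -- Step 3: the top level is empty
  have hFtop : U ⊓ F (a₀ + L) = ⊥ := by
    refine eq_bot_iff.2 fun v hv => ?_
    rw [Submodule.mem_bot, ← hsum v]
    refine Finset.sum_eq_zero fun i hi => ?_
    exact ((hF _ v).1 (Submodule.mem_inf.1 hv).2) _ (by have := Finset.mem_range.1 hi; omega)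
  have hL := step2 L
  rw [hFtop, finrank_bot, add_zero] at hL
  -- Step 4: the `iSup` over `ℤ` is the finite one
  have heq : (⨆ a : ℤ, (U ⊓ F a).map (π a)) = ⨆ i ∈ Finset.range L, (U ⊓ F (a₀ + i)).map (π (a₀ + i)) := by
    apply le_antisymm
    · refine iSup_le fun a => ?_
      by_cases ha : a₀ ≤ a ∧ a < a₀ + L
      · obtain ⟨i, hi⟩ : ∃ i : ℕ, a = a₀ + i := ⟨(a - a₀).toNat, by omega⟩
        have hiL : i ∈ Finset.range L := Finset.mem_range.2 (by omega)
        rw [hi]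
        exact le_iSup₂_of_le (f := fun (i : ℕ) (_ : i ∈ Finset.range L) => (U ⊓ F (a₀ + i)).map (π (a₀ + i))) i hiL le_rfl
      · have h0 : π a = 0 := hvan a (by omega)
        rw [h0, Submodule.map_zero]
        exact bot_le
    · exact iSup₂_le fun i _ => le_iSup (fun a : ℤ => (U ⊓ F a).map (π a)) (a₀ + i)
  rw [heq]; exact hL

/-- resolutions of the identity over any finite weight set containing all weights / levels -/
theorem sum_wtComp' (lvl : Fin m → ℕ) (S : Finset ℤ) (hS : ∀ i j, wt lvl i j ∈ S) (A : Matrix (Fin m) (Fin m) ℂ) :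
    ∑ d ∈ S, wtComp lvl d A = A := by
  ext i j
  rw [Matrix.sum_apply]
  simp only [wtComp, Matrix.of_apply]
  rw [Finset.sum_ite_eq, if_pos (hS i j)]

theorem sum_wtProjM' (P : (Matrix (Fin m) (Fin m) ℂ)ˣ) (lvl : Fin m → ℕ) (S : Finset ℤ) (hS : ∀ i j, wt lvl i j ∈ S)
    (X : Matrix (Fin m) (Fin m) ℂ) : ∑ d ∈ S, wtProjM P lvl d X = X := by
  simp only [wtProjM_apply]
  have h : ∑ d ∈ S, conj P⁻¹ (wtComp lvl d (conj P X)) = conj P⁻¹ (∑ d ∈ S, wtComp lvl d (conj P X)) := (conj_sum _ _ _).symm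
  rw [h, sum_wtComp' lvl S hS, conj_inv_conj]

theorem sum_wtDiag' (lvl : Fin m → ℕ) (S : Finset ℤ) (hS : ∀ i, (lvl i : ℤ) ∈ S) : ∑ a ∈ S, wtDiag lvl a = 1 := by
  ext i j
  rw [Matrix.sum_apply]
  by_cases hij : i = j
  · subst hij
    simp only [wtDiag, Matrix.diagonal_apply_eq, Matrix.one_apply_eq]
    rw [Finset.sum_ite_eq, if_pos (hS i)]
  · simp [wtDiag, Matrix.diagonal_apply_ne _ hij, Matrix.one_apply_ne hij]

theorem sum_wtProjV' (P : (Matrix (Fin m) (Fin m) ℂ)ˣ) (lvl : Fin m → ℕ) (S : Finset ℤ) (hS : ∀ i, (lvl i : ℤ) ∈ S)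
    (v : Fin m → ℂ) : ∑ a ∈ S, wtProjV P lvl a v = v := by
  simp only [wtProjV_apply]
  rw [← Matrix.mulVec_sum, ← Matrix.sum_mulVec, sum_wtDiag' lvl S hS, Matrix.one_mulVec, Matrix.mulVec_mulVec, Units.inv_mul,
    Matrix.one_mulVec]

theorem wtDiag_eq_zero (lvl : Fin m → ℕ) (a : ℤ) (h : ∀ i, (lvl i : ℤ) ≠ a) : wtDiag lvl a = 0 := by
  have e : (fun i => if (lvl i : ℤ) = a then (1 : ℂ) else 0) = fun _ => 0 := funext fun i => if_neg (h i)
  rw [wtDiag, e, Matrix.diagonal_zero]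

theorem wtProjV_eq_zero (P : (Matrix (Fin m) (Fin m) ℂ)ˣ) (lvl : Fin m → ℕ) (a : ℤ) (h : ∀ i, (lvl i : ℤ) ≠ a) :
    wtProjV P lvl a = 0 :=
  LinearMap.ext fun v => by
    rw [wtProjV_apply, wtDiag_eq_zero lvl a h, Matrix.zero_mulVec, Matrix.mulVec_zero, LinearMap.zero_apply]

theorem mem_flagSub_iff_wtProjV (P : (Matrix (Fin m) (Fin m) ℂ)ˣ) (lvl : Fin m → ℕ) (a : ℤ) (v : Fin m → ℂ) :
    v ∈ flagSub P lvl a ↔ ∀ b < a, wtProjV P lvl b v = 0 := by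
  constructor
  · intro hv b hb
    rw [wtProjV_apply]
    suffices h : wtDiag lvl b *ᵥ ((P : Matrix (Fin m) (Fin m) ℂ) *ᵥ v) = 0 by rw [h, Matrix.mulVec_zero]
    ext i
    rw [wtDiag, Matrix.mulVec_diagonal, Pi.zero_apply]
    by_cases h : (lvl i : ℤ) = b
    · rw [if_pos h, one_mul]; exact hv i (by omega)
    · rw [if_neg h, zero_mul]
  · intro h i hi
    have h1 := h (lvl i) hi
    have h2 := P_mulVec_wtProjV P lvl (lvl i) v
    rw [h1, Matrix.mulVec_zero] at h2
    have h3 := congr_fun h2 i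
    rw [Pi.zero_apply, wtDiag, Matrix.mulVec_diagonal, if_pos rfl, one_mul] at h3
    exact h3.symm

theorem wtComp_wtComp (lvl : Fin m → ℕ) (a b : ℤ) (A : Matrix (Fin m) (Fin m) ℂ) :
    wtComp lvl a (wtComp lvl b A) = if a = b then wtComp lvl b A else 0 := by
  split_ifs with hab
  · subst hab
    ext i j; simp only [wtComp, Matrix.of_apply]; split_ifs <;> rfl
  · ext i j
    simp only [wtComp, Matrix.of_apply, Matrix.zero_apply]
    split_ifs with h1 h2
    · exact absurd (h1.symm.trans h2) hab
    · rfl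
    · rfl

theorem wtProjM_wtProjM (P : (Matrix (Fin m) (Fin m) ℂ)ˣ) (lvl : Fin m → ℕ) (a b : ℤ) (X : Matrix (Fin m) (Fin m) ℂ) :
    wtProjM P lvl a (wtProjM P lvl b X) = if a = b then wtProjM P lvl b X else 0 := by
  simp only [wtProjM_apply, conj_conj_inv, wtComp_wtComp]
  split_ifs
  · rfl
  · exact conj_zero _

theorem wtComp_eq_zero_of_ne (lvl : Fin m → ℕ) (d : ℤ) (A : Matrix (Fin m) (Fin m) ℂ) (h : ∀ i j, wt lvl i j ≠ d) :
    wtComp lvl d A = 0 := by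
  ext i j
  simp only [wtComp, Matrix.of_apply, Matrix.zero_apply]
  rw [if_neg (h i j)]

theorem wtProjM_eq_zero (P : (Matrix (Fin m) (Fin m) ℂ)ˣ) (lvl : Fin m → ℕ) (d : ℤ) (h : ∀ i j, wt lvl i j ≠ d) :
    wtProjM P lvl d = 0 :=
  LinearMap.ext fun X => by rw [wtProjM_apply, wtComp_eq_zero_of_ne lvl d _ h, conj_zero, LinearMap.zero_apply]

theorem mem_wtFilt_iff_wtProjM (P : (Matrix (Fin m) (Fin m) ℂ)ˣ) (lvl : Fin m → ℕ) (d : ℤ) (X : Matrix (Fin m) (Fin m) ℂ) :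
    X ∈ wtFilt P lvl d ↔ ∀ b < d, wtProjM P lvl b X = 0 := by
  constructor
  · intro hX b hb
    have h := conj_apply_eq_zero_of_mem_wtFilt hX
    rw [wtProjM_apply]
    suffices h0 : wtComp lvl b (conj P X) = 0 by rw [h0, conj_zero]
    ext i j
    simp only [wtComp, Matrix.of_apply, Matrix.zero_apply]
    split_ifs with h1
    · exact h i j (by omega)
    · rfl
  · intro h
    apply Submodule.subset_span
    intro i j hij
    have h1 := h (wt lvl i j) hij
    have h2 : wtComp lvl (wt lvl i j) (conj P X) = 0 := by
      rw [← conj_conj_inv P (wtComp lvl (wt lvl i j) (conj P X)), ← wtProjM_apply, h1, conj_zero]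
    have h3 := congr_fun (congr_fun h2 i) j
    simp only [wtComp, Matrix.of_apply, Matrix.zero_apply] at h3
    exact h3

/-! ### The pieces -/

theorem conj_eval {n : ℕ} (N : AffMat n m) (P : (Matrix (Fin m) (Fin m) ℂ)ˣ) (v : Fin n × Fin n → ℂ) :
    ((P : Matrix (Fin m) (Fin m) ℂ).map C * N * (↑P⁻¹ : Matrix (Fin m) (Fin m) ℂ).map C :
        Matrix (Fin m) (Fin m) (MvPolynomial (Fin n × Fin n) ℂ)).map (MvPolynomial.eval v) =
      conj P (N.map (MvPolynomial.eval v)) := by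
  rw [Matrix.map_mul, Matrix.map_mul, Matrix.map_map, Matrix.map_map]
  have h : (MvPolynomial.eval v) ∘ (C : ℂ → MvPolynomial (Fin n × Fin n) ℂ) = id :=
    funext fun a => MvPolynomial.eval_C a
  rw [h, Matrix.map_id, Matrix.map_id]
  rfl

/-- (E) an entry of the conjugated affine pencil vanishes iff it vanishes at every evaluation point. -/
theorem L1_entry_eq_zero_iff {n : ℕ} (N : AffMat n m) (P : (Matrix (Fin m) (Fin m) ℂ)ˣ) (i j : Fin m) :
    ((P : Matrix (Fin m) (Fin m) ℂ).map C * N * (↑P⁻¹ : Matrix (Fin m) (Fin m) ℂ).map C :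
        Matrix (Fin m) (Fin m) (MvPolynomial (Fin n × Fin n) ℂ)) i j = 0 ↔
      ∀ v : Fin n × Fin n → ℂ, conj P (N.map (MvPolynomial.eval v)) i j = 0 := by
  constructor
  · intro h v
    rw [← conj_eval N P v, Matrix.map_apply, h, map_zero]
  · intro h
    apply MvPolynomial.funext
    intro v
    rw [map_zero, ← Matrix.map_apply (f := MvPolynomial.eval v), conj_eval N P v]
    exact h v

/-- (S1) entrywise shift ⟺ flag incidence. -/
theorem L1_shifts_iff (P : (Matrix (Fin m) (Fin m) ℂ)ˣ) (lvl : Fin m → ℕ) (e : ℤ) (X : Matrix (Fin m) (Fin m) ℂ) :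
    Shifts P lvl e X ↔ ∀ ℓ : ℤ, ∀ v ∈ flagSub P lvl ℓ, X *ᵥ v ∈ flagSub P lvl (ℓ + e) := by
  have key : ∀ v : Fin m → ℂ, (P : Matrix (Fin m) (Fin m) ℂ) *ᵥ (X *ᵥ v) =
      conj P X *ᵥ ((P : Matrix (Fin m) (Fin m) ℂ) *ᵥ v) := by
    intro v
    rw [Matrix.mulVec_mulVec, Matrix.mulVec_mulVec]
    congr 1
    simp only [conj, Matrix.mul_assoc]
    rw [Units.inv_mul, Matrix.mul_one]
  constructor
  · intro h ℓ v hv i hi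
    rw [key]
    change ∑ j, conj P X i j * ((P : Matrix (Fin m) (Fin m) ℂ) *ᵥ v) j = 0
    apply Finset.sum_eq_zero
    intro j _
    by_cases hj : (lvl j : ℤ) < ℓ
    · rw [hv j hj, mul_zero]
    · rw [h i j (by omega), zero_mul]
  · intro h i j hij
    have hPv : (P : Matrix (Fin m) (Fin m) ℂ) *ᵥ ((↑P⁻¹ : Matrix (Fin m) (Fin m) ℂ) *ᵥ Pi.single j 1) =
        Pi.single j 1 := by
      rw [Matrix.mulVec_mulVec, Units.mul_inv, Matrix.one_mulVec]
    have hv : (↑P⁻¹ : Matrix (Fin m) (Fin m) ℂ) *ᵥ (Pi.single j (1 : ℂ)) ∈ flagSub P lvl (lvl j) := by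
      intro i' hi'
      rw [hPv]
      exact Pi.single_eq_of_ne (fun h' => by rw [h'] at hi'; exact lt_irrefl _ hi') 1
    have h2 := h (lvl j) _ hv i hij
    rw [key, hPv, Matrix.mulVec_single_one] at h2
    exact h2

/-- (G1) `gr` preserves dimension (telescoping ranks along `U ∩ V_{≥a}`). -/
theorem L1_finrank_grSub (P : (Matrix (Fin m) (Fin m) ℂ)ˣ) (lvl : Fin m → ℕ) (U : Submodule ℂ (Fin m → ℂ)) :
    Module.finrank ℂ (grSub P lvl U) = Module.finrank ℂ U := by
  have hlvl : ∀ i, lvl i < Finset.univ.sup lvl + 1 := fun i => Nat.lt_succ_of_le (Finset.le_sup (Finset.mem_univ i))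
  unfold grSub
  refine finrank_gr_abstract (fun a => wtProjV P lvl a) 0 (Finset.univ.sup lvl + 1) (fun a b v => wtProjV_wtProjV P lvl a b v)
    ?_ ?_ (flagSub P lvl) (fun a v => mem_flagSub_iff_wtProjV P lvl a v) U
  · intro v
    simp only [zero_add]
    rw [← Finset.sum_image (s := Finset.range (Finset.univ.sup lvl + 1)) (g := fun i : ℕ => (i : ℤ))
      (f := fun a : ℤ => wtProjV P lvl a v) (fun x _ y _ h => by simpa using h)]
    exact sum_wtProjV' P lvl _ (fun i => Finset.mem_image.2 ⟨lvl i, Finset.mem_range.2 (hlvl i), rfl⟩) v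
  · intro a ha
    exact wtProjV_eq_zero P lvl a (fun i => by have := hlvl i; omega)

/-- (G1, matrix side) the same for the ad-grading. -/
theorem L1_finrank_grMat (P : (Matrix (Fin m) (Fin m) ℂ)ˣ) (lvl : Fin m → ℕ)
    (𝒞 : Submodule ℂ (Matrix (Fin m) (Fin m) ℂ)) :
    Module.finrank ℂ (grMat P lvl 𝒞) = Module.finrank ℂ 𝒞 := by
  have hlvl : ∀ i, lvl i < Finset.univ.sup lvl + 1 := fun i => Nat.lt_succ_of_le (Finset.le_sup (Finset.mem_univ i))
  have hwt : ∀ i j, -((Finset.univ.sup lvl + 1 : ℕ) : ℤ) < wt lvl i j ∧ wt lvl i j < ((Finset.univ.sup lvl + 1 : ℕ) : ℤ) := by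
    intro i j; unfold wt; have := hlvl i; have := hlvl j; omega
  unfold grMat
  refine finrank_gr_abstract (fun d => wtProjM P lvl d) (-((Finset.univ.sup lvl + 1 : ℕ) : ℤ)) (2 * (Finset.univ.sup lvl + 1) + 1)
    (fun a b X => wtProjM_wtProjM P lvl a b X) ?_ ?_ (wtFilt P lvl) (fun d X => mem_wtFilt_iff_wtProjM P lvl d X) 𝒞
  · intro X
    rw [← Finset.sum_image (s := Finset.range (2 * (Finset.univ.sup lvl + 1) + 1))
      (g := fun i : ℕ => -((Finset.univ.sup lvl + 1 : ℕ) : ℤ) + (i : ℤ)) (f := fun d : ℤ => wtProjM P lvl d X)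
      (fun x _ y _ h => by simpa using h)]
    refine sum_wtProjM' P lvl _ (fun i j => Finset.mem_image.2 ?_) X
    refine ⟨(wt lvl i j + ((Finset.univ.sup lvl + 1 : ℕ) : ℤ)).toNat, Finset.mem_range.2 ?_, ?_⟩
    · have := hwt i j; omega
    · have := hwt i j; omega
  · intro a ha
    exact wtProjM_eq_zero P lvl a (fun i j => by have := hwt i j; omega)

/-- (G2) `gr` is monotone. -/
theorem L1_grSub_mono (P : (Matrix (Fin m) (Fin m) ℂ)ˣ) (lvl : Fin m → ℕ) {U U' : Submodule ℂ (Fin m → ℂ)}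
    (h : U ≤ U') : grSub P lvl U ≤ grSub P lvl U' := by
  unfold grSub
  exact iSup_mono fun a => Submodule.map_mono (inf_le_inf_right _ h)

/-- (G2') `gr ⊤ = ⊤`. -/
theorem L1_grSub_top (P : (Matrix (Fin m) (Fin m) ℂ)ˣ) (lvl : Fin m → ℕ) : grSub P lvl ⊤ = ⊤ := by
  refine eq_top_iff.2 fun v _ => ?_
  rw [← sum_wtProjV P lvl v]
  refine Submodule.sum_mem _ fun a _ => ?_
  unfold grSub
  refine Submodule.mem_iSup_of_mem a ⟨wtProjV P lvl a v, ⟨Submodule.mem_top, wtProjV_mem_flagSub P lvl a v⟩, ?_⟩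
  rw [wtProjV_wtProjV, if_pos rfl]

/-- (G2'') `gr U` is graded. -/
theorem L1_grSub_graded (P : (Matrix (Fin m) (Fin m) ℂ)ˣ) (lvl : Fin m → ℕ) (U : Submodule ℂ (Fin m → ℂ)) :
    ∀ v ∈ grSub P lvl U, ∀ a : ℤ, wtProjV P lvl a v ∈ grSub P lvl U := by
  intro v hv a
  unfold grSub at hv ⊢
  refine Submodule.iSup_induction
    (motive := fun w : Fin m → ℂ => wtProjV P lvl a w ∈ ⨆ b : ℤ, Submodule.map (wtProjV P lvl b) (U ⊓ flagSub P lvl b))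
    _ hv (fun b w hw => ?_) (by simp) (fun x y hx hy => by
    rw [map_add]; exact Submodule.add_mem _ hx hy)
  obtain ⟨u, hu, rfl⟩ := hw
  rw [wtProjV_wtProjV]
  split_ifs with hab
  · subst hab
    exact Submodule.mem_iSup_of_mem a ⟨u, hu, rfl⟩
  · exact Submodule.zero_mem _

theorem P_mulVec_mulVec (P : (Matrix (Fin m) (Fin m) ℂ)ˣ) (X : Matrix (Fin m) (Fin m) ℂ) (v : Fin m → ℂ) :
    (P : Matrix (Fin m) (Fin m) ℂ) *ᵥ (X *ᵥ v) = conj P X *ᵥ ((P : Matrix (Fin m) (Fin m) ℂ) *ᵥ v) := by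
  rw [Matrix.mulVec_mulVec, Matrix.mulVec_mulVec]
  congr 1
  simp only [conj, Matrix.mul_assoc]
  rw [Units.inv_mul, Matrix.mul_one]

theorem conj_inv_mulVec (P : (Matrix (Fin m) (Fin m) ℂ)ˣ) (M : Matrix (Fin m) (Fin m) ℂ) (u : Fin m → ℂ) :
    conj P⁻¹ M *ᵥ ((↑P⁻¹ : Matrix (Fin m) (Fin m) ℂ) *ᵥ u) = (↑P⁻¹ : Matrix (Fin m) (Fin m) ℂ) *ᵥ (M *ᵥ u) := by
  simp only [conj, inv_inv]
  rw [Matrix.mulVec_mulVec, Matrix.mulVec_mulVec]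
  simp only [Matrix.mul_assoc]
  rw [Units.mul_inv, Matrix.mul_one]

/-- the coordinate identity behind (G3'): `pr_{a+d}(A w) = A_d (pr_a w)` for `A ∈ gl_{≥ d}`, `w ∈ V_{≥ a}` (in the frame). -/
theorem wtComp_mulVec_wtDiag (lvl : Fin m → ℕ) (d a : ℤ) (A : Matrix (Fin m) (Fin m) ℂ) (w : Fin m → ℂ)
    (hA : ∀ i j, wt lvl i j < d → A i j = 0) (hw : ∀ j, (lvl j : ℤ) < a → w j = 0) :
    wtComp lvl d A *ᵥ (wtDiag lvl a *ᵥ w) = wtDiag lvl (a + d) *ᵥ (A *ᵥ w) := by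
  have e1 : wtDiag lvl a *ᵥ w = fun j => (if (lvl j : ℤ) = a then (1 : ℂ) else 0) * w j := by
    ext j; simp [wtDiag, Matrix.mulVec_diagonal]
  have e2 : ∀ u : Fin m → ℂ, wtDiag lvl (a + d) *ᵥ u = fun i => (if (lvl i : ℤ) = a + d then (1 : ℂ) else 0) * u i := by
    intro u; ext i; simp [wtDiag, Matrix.mulVec_diagonal]
  rw [e1, e2]
  ext i
  simp only [Matrix.mulVec, dotProduct, wtComp, Matrix.of_apply]
  rw [Finset.mul_sum]
  refine Finset.sum_congr rfl fun j _ => ?_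
  by_cases hj : (lvl j : ℤ) < a
  · rw [hw j hj]; simp
  · by_cases hja : (lvl j : ℤ) = a
    · have hiff : wt lvl i j = d ↔ (lvl i : ℤ) = a + d := by unfold wt; omega
      by_cases hi : (lvl i : ℤ) = a + d
      · rw [if_pos (hiff.2 hi), if_pos hi, if_pos hja]; ring
      · rw [if_neg (fun h' => hi (hiff.1 h')), if_neg hi]; ring
    · rw [if_neg hja]
      by_cases hi : (lvl i : ℤ) = a + d
      · have hlt : wt lvl i j < d := by unfold wt; omega
        rw [hA i j hlt, if_pos hi]; simp
      · rw [if_neg hi]; simp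

theorem mulVec_mem_flagSub (P : (Matrix (Fin m) (Fin m) ℂ)ˣ) (lvl : Fin m → ℕ) {d a : ℤ} {X : Matrix (Fin m) (Fin m) ℂ}
    (hX : ∀ i j, wt lvl i j < d → conj P X i j = 0) {x : Fin m → ℂ} (hx : x ∈ flagSub P lvl a) :
    X *ᵥ x ∈ flagSub P lvl (a + d) := by
  intro i hi
  rw [P_mulVec_mulVec]
  change ∑ j, conj P X i j * ((P : Matrix (Fin m) (Fin m) ℂ) *ᵥ x) j = 0
  apply Finset.sum_eq_zero
  intro j _
  by_cases hj : (lvl j : ℤ) < a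
  · rw [hx j hj, mul_zero]
  · rw [hX i j (by unfold wt; omega), zero_mul]

/-- `pr_d(X) · pr_a(x) = pr_{a+d}(X x)` for `X ∈ gl_{≥d}`, `x ∈ V_{≥a}`. -/
theorem wtProjM_mulVec_wtProjV (P : (Matrix (Fin m) (Fin m) ℂ)ˣ) (lvl : Fin m → ℕ) {d a : ℤ} {X : Matrix (Fin m) (Fin m) ℂ}
    (hX : ∀ i j, wt lvl i j < d → conj P X i j = 0) {x : Fin m → ℂ} (hx : x ∈ flagSub P lvl a) :
    wtProjM P lvl d X *ᵥ wtProjV P lvl a x = wtProjV P lvl (a + d) (X *ᵥ x) := by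
  have hL : wtProjM P lvl d X *ᵥ wtProjV P lvl a x = (↑P⁻¹ : Matrix (Fin m) (Fin m) ℂ) *ᵥ
      (wtComp lvl d (conj P X) *ᵥ (wtDiag lvl a *ᵥ ((P : Matrix (Fin m) (Fin m) ℂ) *ᵥ x))) := by
    rw [wtProjM_apply, wtProjV_apply, conj_inv_mulVec]
  rw [hL, wtComp_mulVec_wtDiag lvl d a (conj P X) _ hX (fun j hj => hx j hj), wtProjV_apply, P_mulVec_mulVec P X x]

/-- (G3') incidence passes to `gr`: if every `X ∈ 𝒞` maps `U` into `U'`, every `Y ∈ gr 𝒞` maps `gr U` into `gr U'`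
(`pr_{a+d}(X u) = X_d (pr_a u)` for `X ∈ 𝒞 ∩ gl_{≥d}`, `u ∈ U ∩ V_{≥a}`). -/
theorem L1_grIncidence (P : (Matrix (Fin m) (Fin m) ℂ)ˣ) (lvl : Fin m → ℕ)
    {𝒞 : Submodule ℂ (Matrix (Fin m) (Fin m) ℂ)} {U U' : Submodule ℂ (Fin m → ℂ)}
    (h : ∀ X ∈ 𝒞, ∀ u ∈ U, X *ᵥ u ∈ U') :
    ∀ Y ∈ grMat P lvl 𝒞, ∀ u ∈ grSub P lvl U, Y *ᵥ u ∈ grSub P lvl U' := by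
  intro Y hY u hu
  unfold grMat at hY
  refine Submodule.iSup_induction (motive := fun Y : Matrix (Fin m) (Fin m) ℂ => Y *ᵥ u ∈ grSub P lvl U') _ hY
    (fun d Y hY => ?_) (by rw [Matrix.zero_mulVec]; exact Submodule.zero_mem _)
    (fun Y₁ Y₂ h₁ h₂ => by rw [Matrix.add_mulVec]; exact Submodule.add_mem _ h₁ h₂)
  obtain ⟨X, ⟨hX𝒞, hXd⟩, rfl⟩ := hY
  have hXe := conj_apply_eq_zero_of_mem_wtFilt hXd
  unfold grSub at hu ⊢
  refine Submodule.iSup_induction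
    (motive := fun u : Fin m → ℂ => wtProjM P lvl d X *ᵥ u ∈ ⨆ a : ℤ, Submodule.map (wtProjV P lvl a) (U' ⊓ flagSub P lvl a)) _ hu
    (fun a u hu => ?_) (by rw [Matrix.mulVec_zero]; exact Submodule.zero_mem _)
    (fun u₁ u₂ h₁ h₂ => by rw [Matrix.mulVec_add]; exact Submodule.add_mem _ h₁ h₂)
  obtain ⟨x, ⟨hxU, hxa⟩, rfl⟩ := hu
  rw [wtProjM_mulVec_wtProjV P lvl hXe hxa]
  exact Submodule.mem_iSup_of_mem (a + d) ⟨X *ᵥ x, ⟨h X hX𝒞 x hxU, mulVec_mem_flagSub P lvl hXe hxa⟩, rfl⟩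

/-- (G5) a graded matrix space lies in its own `gr`. -/
theorem L1_le_grMat (P : (Matrix (Fin m) (Fin m) ℂ)ˣ) (lvl : Fin m → ℕ) {𝒞 : Submodule ℂ (Matrix (Fin m) (Fin m) ℂ)}
    (hgr : ∀ X ∈ 𝒞, ∀ d : ℤ, wtProjM P lvl d X ∈ 𝒞) : 𝒞 ≤ grMat P lvl 𝒞 := by
  intro X hX
  rw [← sum_wtProjM P lvl X]
  refine Submodule.sum_mem _ fun d _ => ?_
  unfold grMat
  refine Submodule.mem_iSup_of_mem d ⟨wtProjM P lvl d X, ⟨hgr X hX d, ?_⟩, ?_⟩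
  · refine Submodule.subset_span ?_
    intro i j hij
    rw [wtProjM_apply, conj_conj_inv]
    exact wtComp_supported lvl d _ i j hij
  · simp only [wtProjM_apply, conj_conj_inv, wtComp_idem]

/-- (G5') `gr` of a subspace of a graded space stays inside it. -/
theorem L1_grMat_le (P : (Matrix (Fin m) (Fin m) ℂ)ˣ) (lvl : Fin m → ℕ) {𝒞 𝒯 : Submodule ℂ (Matrix (Fin m) (Fin m) ℂ)}
    (hgr : ∀ X ∈ 𝒯, ∀ d : ℤ, wtProjM P lvl d X ∈ 𝒯) (h : 𝒞 ≤ 𝒯) : grMat P lvl 𝒞 ≤ 𝒯 := by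
  unfold grMat
  refine iSup_le fun d => Submodule.map_le_iff_le_comap.2 ?_
  rintro X ⟨hX, -⟩
  exact hgr X (h hX) d

-- (G6) THE FRAME: a chain of graded subspaces `⊤ = G 0 ≥ G 1 ≥ ⋯ ≥ G p = ⊥` is the coordinate flag of a frame
-- diagonalising the grading (adapted eigenbasis, cell by cell) — `exists_adapted_basis` + `L1_adaptedFrame` below.
section AdaptedBasis
open Module

/-- **Adapted eigenbasis.** For orthogonal idempotents `π (a₀ + k)` (`k < L`) summing to `id`, and an antitone chain
`⊤ = G 0 ≥ G 1 ≥ ⋯ ≥ G p = ⊥` of `π`-stable subspaces, there is a basis of `V` consisting of vectors each fixed by one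
`π (a₀ + k)` and each lying in a definite `G ℓ` (`ℓ < p`), such that `G ℓ` is cut out by the vanishing of the coordinates
of label `< ℓ`. -/
theorem exists_adapted_basis {V : Type*} [AddCommGroup V] [Module ℂ V] [FiniteDimensional ℂ V]
    (π : ℤ → V →ₗ[ℂ] V) (a₀ : ℤ) (L : ℕ)
    (horth : ∀ a b (v : V), π a (π b v) = if a = b then π b v else 0)
    (hsum : ∀ v : V, ∑ i ∈ Finset.range L, π (a₀ + i) v = v)
    (G : ℤ → Submodule ℂ V) (p : ℕ)
    (hanti : ∀ ℓ ℓ' : ℤ, ℓ ≤ ℓ' → G ℓ' ≤ G ℓ) (htop : G 0 = ⊤) (hbot : G p = ⊥)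
    (hgr : ∀ ℓ, ∀ v ∈ G ℓ, ∀ a : ℤ, π a v ∈ G ℓ) :
    ∃ (ι : Type) (_ : Fintype ι) (b : Basis ι ℂ V) (wtOf : ι → ℕ) (lvOf : ι → ℕ),
      (∀ i, wtOf i < L) ∧ (∀ i, π (a₀ + wtOf i) (b i) = b i) ∧ (∀ i, lvOf i < p) ∧
      (∀ i, b i ∈ G (lvOf i)) ∧
      (∀ (ℓ : ℤ) (v : V), v ∈ G ℓ → ∀ i, (lvOf i : ℤ) < ℓ → b.repr v i = 0) := by
  classical
  -- weight spaces
  set Va : ℕ → Submodule ℂ V := fun k => LinearMap.range (π (a₀ + k)) with hVa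
  have hVfix : ∀ k : ℕ, ∀ v ∈ Va k, π (a₀ + k) v = v := by
    intro k v hv
    obtain ⟨u, rfl⟩ := LinearMap.mem_range.1 hv
    rw [horth, if_pos rfl]
  -- cells: complements of `G (ℓ+1) ∩ V_k` in `G ℓ ∩ V_k`
  have hex : ∀ c : Fin L × Fin p, ∃ C : Submodule ℂ V, C ≤ G (c.2 : ℕ) ⊓ Va c.1 ∧
      C ⊓ (G ((c.2 : ℕ) + 1) ⊓ Va c.1) = ⊥ ∧ C ⊔ (G ((c.2 : ℕ) + 1) ⊓ Va c.1) = G (c.2 : ℕ) ⊓ Va c.1 := by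
    intro c
    have hBA : G ((c.2 : ℕ) + 1) ⊓ Va c.1 ≤ G (c.2 : ℕ) ⊓ Va c.1 := inf_le_inf_right _ (hanti _ _ (by omega))
    obtain ⟨C', hC'⟩ := Submodule.exists_isCompl ((G ((c.2 : ℕ) + 1) ⊓ Va c.1).comap (G (c.2 : ℕ) ⊓ Va c.1).subtype)
    refine ⟨C'.map (G (c.2 : ℕ) ⊓ Va c.1).subtype, Submodule.map_subtype_le _ C', ?_, ?_⟩
    · have h1 := congrArg (Submodule.map (G (c.2 : ℕ) ⊓ Va c.1).subtype) hC'.inf_eq_bot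
      rw [Submodule.map_bot, Submodule.map_inf _ (Submodule.injective_subtype _), Submodule.map_comap_subtype,
        inf_eq_right.2 hBA] at h1
      rwa [inf_comm] at h1
    · have h2 := congrArg (Submodule.map (G (c.2 : ℕ) ⊓ Va c.1).subtype) hC'.sup_eq_top
      rw [Submodule.map_top, Submodule.range_subtype, Submodule.map_sup, Submodule.map_comap_subtype,
        inf_eq_right.2 hBA] at h2
      rwa [sup_comm] at h2
  choose C hCle hCinf hCsup using hex
  have hfin : ∀ c : Fin L × Fin p, finrank ℂ ↥(C c) + finrank ℂ ↥(G ((c.2 : ℕ) + 1) ⊓ Va c.1) =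
      finrank ℂ ↥(G (c.2 : ℕ) ⊓ Va c.1) := by
    intro c
    have h := Submodule.finrank_sup_add_finrank_inf_eq (C c) (G ((c.2 : ℕ) + 1) ⊓ Va c.1)
    rw [hCsup, hCinf, finrank_bot, add_zero] at h
    exact h.symm
  -- the family: bases of the cells
  let ι := Σ c : Fin L × Fin p, Fin (finrank ℂ ↥(C c))
  let w : ι → V := fun x => ((finBasis ℂ ↥(C x.1)) x.2 : V)
  have hwC : ∀ x : ι, w x ∈ C x.1 := fun x => ((finBasis ℂ ↥(C x.1)) x.2).2
  have hCspan : ∀ (S : Submodule ℂ V) (c : Fin L × Fin p), (∀ j, w ⟨c, j⟩ ∈ S) → C c ≤ S := by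
    intro S c hS x hx
    have e := congrArg Subtype.val ((finBasis ℂ ↥(C c)).sum_repr ⟨x, hx⟩)
    simp only [Submodule.coe_sum, Submodule.coe_smul] at e
    rw [← e]
    exact S.sum_mem fun j _ => S.smul_mem _ (hS j)
  -- downward induction along the chain inside one weight space
  have hdown : ∀ (S : Submodule ℂ V) (ℓ₀ : ℕ), (∀ c : Fin L × Fin p, ℓ₀ ≤ (c.2 : ℕ) → C c ≤ S) →
      ∀ (k : Fin L) (ℓ : ℕ), ℓ₀ ≤ ℓ → ℓ ≤ p → G (ℓ : ℤ) ⊓ Va k ≤ S := by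
    intro S ℓ₀ hS k
    suffices h : ∀ d ℓ : ℕ, ℓ + d = p → ℓ₀ ≤ ℓ → G (ℓ : ℤ) ⊓ Va k ≤ S from
      fun ℓ h1 h2 => h (p - ℓ) ℓ (by omega) h1
    intro d
    induction d with
    | zero =>
      intro ℓ hℓ _ v hv
      have h1 := (Submodule.mem_inf.1 hv).1
      rw [show (ℓ : ℤ) = p by exact_mod_cast hℓ, hbot, Submodule.mem_bot] at h1
      rw [h1]; exact S.zero_mem
    | succ d ih =>
      intro ℓ hℓ hℓ₀
      have hℓp : ℓ < p := by omega
      have e := hCsup (k, ⟨ℓ, hℓp⟩)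
      simp only at e
      rw [← e]
      refine sup_le (hS _ (by simpa using hℓ₀)) ?_
      have := ih (ℓ + 1) (by omega) (by omega)
      push_cast at this
      exact this
  -- spanning
  have hspan : ⊤ ≤ Submodule.span ℂ (Set.range w) := by
    intro v _
    rw [← hsum v]
    refine Submodule.sum_mem _ fun k hk => ?_
    have hkL := Finset.mem_range.1 hk
    have h1 : π (a₀ + k) v ∈ G ((0 : ℕ) : ℤ) ⊓ Va k :=
      ⟨by rw [Nat.cast_zero, htop]; trivial, LinearMap.mem_range_self _ _⟩
    exact hdown (Submodule.span ℂ (Set.range w)) 0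
      (fun c _ => hCspan _ c fun j => Submodule.subset_span ⟨⟨c, j⟩, rfl⟩) ⟨k, hkL⟩ 0 le_rfl (Nat.zero_le _) h1
  -- counting: Σ finrank (cells) = finrank V
  have hfin' : ∀ (k : Fin L) (ℓ : ℕ) (h : ℓ < p),
      finrank ℂ ↥(C (k, ⟨ℓ, h⟩)) + finrank ℂ ↥(G ((ℓ : ℤ) + 1) ⊓ Va k) = finrank ℂ ↥(G (ℓ : ℤ) ⊓ Va k) :=
    fun k ℓ h => hfin (k, ⟨ℓ, h⟩)
  have hcol : ∀ k : Fin L, ∑ ℓ : Fin p, finrank ℂ ↥(C (k, ℓ)) = finrank ℂ ↥(Va k) := by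
    intro k
    let f : ℕ → ℕ := fun ℓ => if h : ℓ < p then finrank ℂ ↥(C (k, ⟨ℓ, h⟩)) else 0
    have htel : ∀ q : ℕ, q ≤ p → ∑ ℓ ∈ Finset.range q, f ℓ + finrank ℂ ↥(G (q : ℤ) ⊓ Va k) =
        finrank ℂ ↥(G ((0 : ℕ) : ℤ) ⊓ Va k) := by
      intro q
      induction q with
      | zero => intro _; rw [Finset.sum_range_zero, zero_add]
      | succ q ih =>
        intro hq
        have hqp : q < p := by omega
        have hf : f q = finrank ℂ ↥(C (k, ⟨q, hqp⟩)) := by simp only [f, dif_pos hqp]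
        rw [Finset.sum_range_succ, Nat.cast_succ, hf, add_assoc, hfin' k q hqp]
        exact ih (by omega)
    have hp := htel p le_rfl
    rw [hbot, Nat.cast_zero, htop, bot_inf_eq, top_inf_eq, finrank_bot, add_zero] at hp
    rw [← hp, ← Fin.sum_univ_eq_sum_range]
    refine Finset.sum_congr rfl fun ℓ _ => ?_
    simp only [f, dif_pos ℓ.isLt, Fin.eta]
  have hrow : ∑ k : Fin L, finrank ℂ ↥(Va k) = finrank ℂ V := by
    have hind : ∀ q : ℕ, finrank ℂ ↥(⨆ k ∈ Finset.range q, Va k) = ∑ k ∈ Finset.range q, finrank ℂ ↥(Va k) := by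
      intro q
      induction q with
      | zero =>
        have h1 : (⨆ k ∈ Finset.range 0, Va k) = ⊥ := by
          rw [eq_bot_iff]; exact iSup₂_le fun i hi => by simp at hi
        rw [h1, finrank_bot, Finset.sum_range_zero]
      | succ q ih =>
        rw [Finset.range_add_one, Finset.iSup_insert, Finset.sum_insert (by simp)]
        have hdisj : Va q ⊓ (⨆ k ∈ Finset.range q, Va k) = ⊥ := by
          refine eq_bot_iff.2 fun v hv => ?_
          obtain ⟨hv1, hv2⟩ := Submodule.mem_inf.1 hv
          have hker : (⨆ k ∈ Finset.range q, Va k) ≤ LinearMap.ker (π (a₀ + q)) := by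
            refine iSup₂_le fun i hi u hu => LinearMap.mem_ker.2 ?_
            obtain ⟨u', rfl⟩ := LinearMap.mem_range.1 hu
            rw [horth, if_neg (by have := Finset.mem_range.1 hi; omega)]
          have h0 := LinearMap.mem_ker.1 (hker hv2)
          rw [hVfix q v hv1] at h0
          rw [Submodule.mem_bot]; exact h0
        have hsup := Submodule.finrank_sup_add_finrank_inf_eq (Va q) (⨆ k ∈ Finset.range q, Va k)
        rw [hdisj, finrank_bot, add_zero] at hsup
        rw [hsup, ih]
    have htop' : (⨆ k ∈ Finset.range L, Va k) = ⊤ := by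
      refine eq_top_iff.2 fun v _ => ?_
      rw [← hsum v]
      refine Submodule.sum_mem _ fun k hk => ?_
      exact le_iSup₂_of_le (f := fun (k : ℕ) (_ : k ∈ Finset.range L) => Va k) k hk le_rfl (LinearMap.mem_range_self _ _)
    rw [Fin.sum_univ_eq_sum_range (fun k => finrank ℂ ↥(Va k)) L, ← hind L, htop', finrank_top]
  have hcard : Fintype.card ι = finrank ℂ V := by
    rw [← hrow]
    simp only [ι, Fintype.card_sigma, Fintype.card_fin]
    rw [Fintype.sum_prod_type]
    exact Finset.sum_congr rfl fun k _ => hcol k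
  -- the basis
  let b : Basis ι ℂ V := basisOfTopLeSpanOfCardEqFinrank w hspan hcard
  have hb : ∀ x, b x = w x := fun x => congrFun (coe_basisOfTopLeSpanOfCardEqFinrank w hspan hcard) x
  refine ⟨ι, inferInstance, b, fun x => x.1.1, fun x => x.1.2, fun x => x.1.1.isLt, ?_, fun x => x.1.2.isLt, ?_, ?_⟩
  · intro x; rw [hb]; exact hVfix _ _ ((hCle x.1) (hwC x)).2
  · intro x; rw [hb]; exact ((hCle x.1) (hwC x)).1
  · intro ℓ v hv x hx
    by_cases hℓp : (p : ℤ) ≤ ℓ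
    · have h0 : v = 0 := by
        have := hanti _ _ hℓp hv
        rwa [hbot, Submodule.mem_bot] at this
      rw [h0, map_zero, Finsupp.zero_apply]
    · obtain ⟨ℓn, rfl⟩ : ∃ ℓn : ℕ, ℓ = ℓn := ⟨ℓ.toNat, by omega⟩
      let Sℓ : Set ι := {y | ℓn ≤ (y.1.2 : ℕ)}
      have hGle : G ℓn ≤ Submodule.span ℂ (b '' Sℓ) := by
        intro u hu
        rw [← hsum u]
        refine Submodule.sum_mem _ fun k hk => ?_
        have hkL := Finset.mem_range.1 hk
        have h1 : π (a₀ + k) u ∈ G (ℓn : ℤ) ⊓ Va k := ⟨hgr _ u hu _, LinearMap.mem_range_self _ _⟩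
        exact hdown (Submodule.span ℂ (b '' Sℓ)) ℓn (fun c hc => hCspan _ c fun j =>
          Submodule.subset_span ⟨⟨c, j⟩, hc, hb ⟨c, j⟩⟩) ⟨k, hkL⟩ ℓn le_rfl (by omega) h1
      have hsupp := b.repr_support_subset_of_mem_span Sℓ (hGle hv)
      by_contra hne
      have hmem : x ∈ ((b.repr v).support : Set ι) := Finsupp.mem_support_iff.2 hne
      have hx' := hsupp hmem
      simp only [Sℓ, Set.mem_setOf_eq] at hx'
      push_cast at hx
      omega

end AdaptedBasis

/-- Eigenvectors of the grading operator: if `pr_k v = v` then `H v = k • v`. -/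
theorem gradingOp_mulVec_of_fix (P : (Matrix (Fin m) (Fin m) ℂ)ˣ) (lvl : Fin m → ℕ) (k : ℕ) (v : Fin m → ℂ)
    (hv : wtProjV P lvl (k : ℤ) v = v) : gradingOp P lvl *ᵥ v = (k : ℂ) • v := by
  have h1 : (P : Matrix (Fin m) (Fin m) ℂ) *ᵥ v = wtDiag lvl (k : ℤ) *ᵥ ((P : Matrix (Fin m) (Fin m) ℂ) *ᵥ v) := by
    conv_lhs => rw [← hv]
    exact P_mulVec_wtProjV P lvl k v
  have h2 : Matrix.diagonal (fun i => (lvl i : ℂ)) * wtDiag lvl (k : ℤ) = (k : ℂ) • wtDiag lvl (k : ℤ) := by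
    simp only [wtDiag, Matrix.diagonal_mul_diagonal, ← Matrix.diagonal_smul]
    congr 1
    funext i
    simp only [Pi.smul_apply, smul_eq_mul]
    split_ifs with h
    · have : lvl i = k := by exact_mod_cast h
      rw [this]
    · simp
  calc gradingOp P lvl *ᵥ v
      = (↑P⁻¹ : Matrix (Fin m) (Fin m) ℂ) *ᵥ (Matrix.diagonal (fun i => (lvl i : ℂ)) *ᵥ ((P : Matrix (Fin m) (Fin m) ℂ) *ᵥ v)) := by
        simp only [gradingOp, conj, inv_inv, Matrix.mulVec_mulVec, Matrix.mul_assoc]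
    _ = (↑P⁻¹ : Matrix (Fin m) (Fin m) ℂ) *ᵥ
          ((Matrix.diagonal (fun i => (lvl i : ℂ)) * wtDiag lvl (k : ℤ)) *ᵥ ((P : Matrix (Fin m) (Fin m) ℂ) *ᵥ v)) := by
        rw [← Matrix.mulVec_mulVec _ (Matrix.diagonal fun i => (lvl i : ℂ)) (wtDiag lvl (k : ℤ)), ← h1]
    _ = (k : ℂ) • v := by
        rw [h2, Matrix.smul_mulVec, Matrix.mulVec_smul, ← wtProjV_apply, hv]

/-- (L1-frame, PROVED) **adapted eigenframe**: a graded chain of subspaces is the flag of a cocharacter with the same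
grading operator.  From `exists_adapted_basis` by reindexing the basis to `Fin m` and taking `P'` = the coordinate map. -/
theorem L1_adaptedFrame (P : (Matrix (Fin m) (Fin m) ℂ)ˣ) (lvl : Fin m → ℕ) (G : ℤ → Submodule ℂ (Fin m → ℂ)) (p : ℕ)
    (hanti : ∀ ℓ ℓ' : ℤ, ℓ ≤ ℓ' → G ℓ' ≤ G ℓ) (htop : G 0 = ⊤) (hbot : G p = ⊥)
    (hgr : ∀ ℓ, ∀ v ∈ G ℓ, ∀ a : ℤ, wtProjV P lvl a v ∈ G ℓ) :
    ∃ (P' : (Matrix (Fin m) (Fin m) ℂ)ˣ) (lvl₀ lvl' : Fin m → ℕ),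
      gradingOp P' lvl₀ = gradingOp P lvl ∧ (∀ ℓ : ℤ, flagSub P' lvl' ℓ = G ℓ) ∧ ∀ i, lvl' i < p := by
  classical
  have hlvl : ∀ i, lvl i < Finset.univ.sup lvl + 1 := fun i => Nat.lt_succ_of_le (Finset.le_sup (Finset.mem_univ i))
  have hsum' : ∀ v : Fin m → ℂ, ∑ i ∈ Finset.range (Finset.univ.sup lvl + 1), wtProjV P lvl ((0 : ℤ) + i) v = v := by
    intro v
    simp only [zero_add]
    rw [← Finset.sum_image (s := Finset.range (Finset.univ.sup lvl + 1)) (g := fun i : ℕ => (i : ℤ))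
      (f := fun a : ℤ => wtProjV P lvl a v) (fun x _ y _ h => by simpa using h)]
    exact sum_wtProjV' P lvl _ (fun i => Finset.mem_image.2 ⟨lvl i, Finset.mem_range.2 (hlvl i), rfl⟩) v
  obtain ⟨ι, hι, b, wtOf, lvOf, -, hfix, hlv, hbG, hrepr⟩ := exists_adapted_basis (fun a => wtProjV P lvl a) 0
    (Finset.univ.sup lvl + 1) (fun a b v => wtProjV_wtProjV P lvl a b v) hsum' G p hanti htop hbot hgr
  have hcard : Fintype.card ι = m := by
    have h := Module.finrank_eq_card_basis b
    simpa using h.symm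
  let e : ι ≃ Fin m := Fintype.equivFinOfCardEq hcard
  let b' : Module.Basis (Fin m) ℂ (Fin m → ℂ) := b.reindex e
  let Bm : Matrix (Fin m) (Fin m) ℂ := (Pi.basisFun ℂ (Fin m)).toMatrix b'
  let Pm : Matrix (Fin m) (Fin m) ℂ := b'.toMatrix (Pi.basisFun ℂ (Fin m))
  have hPB : Pm * Bm = 1 := Module.Basis.toMatrix_mul_toMatrix_flip _ _
  have hBP : Bm * Pm = 1 := Module.Basis.toMatrix_mul_toMatrix_flip _ _
  let P' : (Matrix (Fin m) (Fin m) ℂ)ˣ := ⟨Pm, Bm, hPB, hBP⟩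
  have hPv : ∀ v : Fin m → ℂ, (P' : Matrix (Fin m) (Fin m) ℂ) *ᵥ v = ⇑(b'.repr v) := by
    intro v
    have h := (Pi.basisFun ℂ (Fin m)).toMatrix_mulVec_repr b' v
    have h0 : ⇑((Pi.basisFun ℂ (Fin m)).repr v) = v := funext fun i => by simp
    rw [h0] at h
    exact h
  have hBcol : ∀ j, (↑P'⁻¹ : Matrix (Fin m) (Fin m) ℂ) *ᵥ Pi.single j 1 = b' j := by
    intro j
    show Bm *ᵥ Pi.single j 1 = b' j
    rw [Matrix.mulVec_single_one]
    funext i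
    simp only [Matrix.col_apply, Bm, Module.Basis.toMatrix_apply, Pi.basisFun_repr]
  refine ⟨P', fun i => wtOf (e.symm i), fun i => lvOf (e.symm i), ?_, ?_, fun i => hlv _⟩
  · refine (Matrix.toLin' (R := ℂ)).injective (b'.ext fun j => ?_)
    rw [Matrix.toLin'_apply, Matrix.toLin'_apply]
    have hfixj : wtProjV P lvl ((wtOf (e.symm j) : ℕ) : ℤ) (b' j) = b' j := by
      have := hfix (e.symm j)
      rw [zero_add] at this
      rw [Module.Basis.reindex_apply]
      exact this
    rw [gradingOp_mulVec_of_fix P lvl _ (b' j) hfixj]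
    simp only [gradingOp, conj, inv_inv]
    rw [← Matrix.mulVec_mulVec, ← Matrix.mulVec_mulVec, hPv, Module.Basis.repr_self, Finsupp.single_eq_pi_single,
      Matrix.diagonal_mulVec_single, mul_one]
    have hs : (Pi.single j ((wtOf (e.symm j) : ℕ) : ℂ) : Fin m → ℂ) = ((wtOf (e.symm j) : ℕ) : ℂ) • Pi.single j 1 := by
      ext i
      by_cases h : i = j
      · subst h; simp
      · simp [h]
    rw [hs, Matrix.mulVec_smul, hBcol]
  · intro ℓ
    ext v
    rw [mem_flagSub]
    simp only [hPv]
    constructor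
    · intro h
      rw [← b'.sum_repr v]
      refine Submodule.sum_mem _ fun i _ => ?_
      by_cases hi : ((lvOf (e.symm i) : ℕ) : ℤ) < ℓ
      · rw [h i hi, zero_smul]; exact Submodule.zero_mem _
      · refine Submodule.smul_mem _ _ (hanti ℓ ((lvOf (e.symm i) : ℕ) : ℤ) (by omega) ?_)
        rw [Module.Basis.reindex_apply]
        exact hbG (e.symm i)
    · intro hv i hi
      rw [Module.Basis.repr_reindex_apply]
      exact hrepr ℓ v hv (e.symm i) hi

/-- (B1) rank–nullity, restricted. -/
theorem L1_finrank_le_map_add_ker {V W : Type*} [AddCommGroup V] [Module ℂ V] [AddCommGroup W] [Module ℂ W]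
    [FiniteDimensional ℂ V] (T : V →ₗ[ℂ] W) (K : Submodule ℂ V) :
    Module.finrank ℂ K ≤ Module.finrank ℂ (K.map T) + Module.finrank ℂ (LinearMap.ker T) := by
  have h := LinearMap.finrank_range_add_finrank_ker (T.domRestrict K)
  rw [LinearMap.range_domRestrict, LinearMap.ker_domRestrict] at h
  have h2 : Module.finrank ℂ ((LinearMap.ker T).comap K.subtype) ≤ Module.finrank ℂ (LinearMap.ker T) := by
    rw [← Submodule.finrank_map_subtype_eq K, Submodule.map_comap_subtype]
    exact Submodule.finrank_mono inf_le_right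
  omega

/-- (B2) dimension of a preimage of a subspace of the range. -/
theorem L1_finrank_comap {V W : Type*} [AddCommGroup V] [Module ℂ V] [AddCommGroup W] [Module ℂ W]
    [FiniteDimensional ℂ V] (T : V →ₗ[ℂ] W) (S : Submodule ℂ W) (hS : S ≤ LinearMap.range T) :
    Module.finrank ℂ (S.comap T) = Module.finrank ℂ S + Module.finrank ℂ (LinearMap.ker T) := by
  have h := LinearMap.finrank_range_add_finrank_ker (T.domRestrict (S.comap T))
  rw [LinearMap.range_domRestrict, Submodule.map_comap_eq, inf_eq_right.2 hS, LinearMap.ker_domRestrict] at h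
  have hker : LinearMap.ker T ≤ S.comap T := fun v hv => by
    rw [Submodule.mem_comap, LinearMap.mem_ker.1 hv]
    exact S.zero_mem
  have h2 : Module.finrank ℂ ((LinearMap.ker T).comap (S.comap T).subtype) = Module.finrank ℂ (LinearMap.ker T) := by
    rw [← Submodule.finrank_map_subtype_eq (S.comap T), Submodule.map_comap_subtype, inf_eq_right.2 hker]
  omega

/-! ### Composition: L1 from the pieces -/

theorem flagSub_antitone (P : (Matrix (Fin m) (Fin m) ℂ)ˣ) (lvl : Fin m → ℕ) {ℓ ℓ' : ℤ} (h : ℓ ≤ ℓ') :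
    flagSub P lvl ℓ' ≤ flagSub P lvl ℓ := fun _ hv i hi => hv i (lt_of_lt_of_le hi h)

theorem flagSub_zero (P : (Matrix (Fin m) (Fin m) ℂ)ˣ) (lvl : Fin m → ℕ) : flagSub P lvl 0 = ⊤ := by
  ext v; simp only [mem_flagSub, Submodule.mem_top, iff_true]
  intro i hi; omega

theorem flagSub_eq_bot (P : (Matrix (Fin m) (Fin m) ℂ)ˣ) (lvl : Fin m → ℕ) (p : ℕ) (hlvl : ∀ i, lvl i < p) :
    flagSub P lvl p = ⊥ := by
  ext v
  simp only [mem_flagSub, Submodule.mem_bot]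
  constructor
  · intro h
    have hPv : (P : Matrix (Fin m) (Fin m) ℂ) *ᵥ v = 0 := funext fun i => h i (by exact_mod_cast hlvl i)
    have : (↑P⁻¹ : Matrix (Fin m) (Fin m) ℂ) *ᵥ ((P : Matrix (Fin m) (Fin m) ℂ) *ᵥ v) = v := by
      rw [Matrix.mulVec_mulVec, Units.inv_mul, Matrix.one_mulVec]
    rw [← this, hPv, Matrix.mulVec_zero]
  · rintro rfl i _; simp

theorem grSub_bot (P : (Matrix (Fin m) (Fin m) ℂ)ˣ) (lvl : Fin m → ℕ) : grSub P lvl ⊥ = ⊥ := by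
  unfold grSub
  simp

/-- **L1 — THE SYMMETRIC-CERTIFICATE LEMMA, PROVED (v1.10)**: a uniform weight certificate `(P₁, lvl₁; p, r, c; K)` of an
AFFINE pencil graded by the torus `(P, lvl)` (`IsGradedPencil`) can be replaced by one whose cocharacter COMMUTES with that torus
(same grading operator `gradingOp P' lvl₀ = gradingOp P lvl`, same `p, r, c`, a budget space `K'` at least as large).  Sorry-free,
from `L1_finrank_grSub` / `L1_finrank_grMat` (G1), `L1_grIncidence` (G3'), `L1_adaptedFrame` (G6) and the rank–nullity glue. -/
theorem gradedCertificate {n : ℕ} {N : AffMat n m} (hN : IsAffine N) {P : (Matrix (Fin m) (Fin m) ℂ)ˣ}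
    {lvl : Fin m → ℕ} (hgr : IsGradedPencil N P lvl) {P₁ : (Matrix (Fin m) (Fin m) ℂ)ˣ} {lvl₁ : Fin m → ℕ} {p r c : ℕ}
    {K : Submodule ℂ (Fin n × Fin n → ℂ)} (hcert : Certifies N P₁ lvl₁ p r c K) :
    ∃ (P' : (Matrix (Fin m) (Fin m) ℂ)ˣ) (lvl₀ lvl' : Fin m → ℕ) (K' : Submodule ℂ (Fin n × Fin n → ℂ)),
      gradingOp P' lvl₀ = gradingOp P lvl ∧ Certifies N P' lvl' p r c K' := by
  classical
  obtain ⟨hc, hlvl, hdrop, hK, hbudget⟩ := hcert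
  obtain ⟨T, hT⟩ := exists_topMap_linPart N hN
  have hW := isGraded_of_isGradedPencil N P lvl hgr
  -- the certificate flag `F` and its limit `G`
  let F : ℤ → Submodule ℂ (Fin m → ℂ) := fun ℓ => flagSub P₁ lvl₁ ℓ
  let G : ℤ → Submodule ℂ (Fin m → ℂ) := fun ℓ => grSub P lvl (F ℓ)
  have hGanti : ∀ ℓ ℓ' : ℤ, ℓ ≤ ℓ' → G ℓ' ≤ G ℓ := fun ℓ ℓ' h =>
    L1_grSub_mono P lvl (flagSub_antitone P₁ lvl₁ h)
  have hGtop : G 0 = ⊤ := by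
    show grSub P lvl (flagSub P₁ lvl₁ 0) = ⊤
    rw [flagSub_zero, L1_grSub_top]
  have hGbot : G p = ⊥ := by
    show grSub P lvl (flagSub P₁ lvl₁ p) = ⊥
    rw [flagSub_eq_bot P₁ lvl₁ p hlvl, grSub_bot]
  have hGgr : ∀ ℓ, ∀ v ∈ G ℓ, ∀ a : ℤ, wtProjV P lvl a v ∈ G ℓ := fun ℓ => L1_grSub_graded P lvl (F ℓ)
  obtain ⟨P', lvl₀, lvl', hH, hflag, hlvl'⟩ := L1_adaptedFrame P lvl G p hGanti hGtop hGbot hGgr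
  -- every pencil element drops `r` w.r.t. `F`, hence (gr) w.r.t. `G`
  have hWshift : pencilSpace N ≤ shiftSub P₁ lvl₁ (-(r : ℤ)) := by
    have hev : ∀ v : Fin n × Fin n → ℂ, N.map (MvPolynomial.eval v) ∈ shiftSub P₁ lvl₁ (-(r : ℤ)) := by
      intro v i j hij
      have h0 := (L1_entry_eq_zero_iff N P₁ i j).1 (hdrop i j (by omega)) v
      exact h0
    refine Submodule.span_le.2 ?_
    rintro X (hX | ⟨v, rfl⟩)
    · rw [Set.mem_singleton_iff] at hX
      rw [hX]
      exact hev 0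
    · show linPart N v ∈ shiftSub P₁ lvl₁ (-(r : ℤ))
      unfold linPart
      exact Submodule.sub_mem _ (hev v) (hev 0)
  have hWmaps : ∀ ℓ : ℤ, ∀ X ∈ pencilSpace N, ∀ u ∈ F ℓ, X *ᵥ u ∈ F (ℓ + -(r : ℤ)) := fun ℓ X hX u hu =>
    (L1_shifts_iff P₁ lvl₁ _ X).1 (hWshift hX) ℓ u hu
  have hWgr : pencilSpace N ≤ grMat P lvl (pencilSpace N) := L1_le_grMat P lvl (fun X hX d => hW X hX d)
  -- the climbing tops `𝒞` and the new direction space `K'`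
  let 𝒞 : Submodule ℂ (Matrix (Fin m) (Fin m) ℂ) := LinearMap.range T ⊓ shiftSub P₁ lvl₁ c
  let K' : Submodule ℂ (Fin n × Fin n → ℂ) := (grMat P lvl 𝒞).comap T
  have h𝒯gr : ∀ X ∈ LinearMap.range T, ∀ d : ℤ, wtProjM P lvl d X ∈ LinearMap.range T := by
    rintro X ⟨v, rfl⟩ d
    obtain ⟨v', hv'⟩ := hgr.1 v d
    refine ⟨v', ?_⟩
    rw [wtProjM_apply, hT v, hT v', hv']
  have h𝒞maps : ∀ ℓ : ℤ, ∀ X ∈ 𝒞, ∀ u ∈ F ℓ, X *ᵥ u ∈ F (ℓ + c) := fun ℓ X hX u hu =>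
    (L1_shifts_iff P₁ lvl₁ _ X).1 hX.2 ℓ u hu
  refine ⟨P', lvl₀, lvl', K', hH, hc, hlvl', ?_, ?_, ?_⟩
  · -- drops in the new frame
    intro i j hij
    refine (L1_entry_eq_zero_iff N P' i j).2 fun v => ?_
    have hs : Shifts P' lvl' (-(r : ℤ)) (N.map (MvPolynomial.eval v)) := by
      rw [L1_shifts_iff]
      intro ℓ u hu
      rw [hflag] at hu ⊢
      have hXW : N.map (MvPolynomial.eval v) ∈ pencilSpace N := by
        have : N.map (MvPolynomial.eval v) = N.map (MvPolynomial.eval 0) + linPart N v := by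
          unfold linPart; abel
        rw [this]
        exact Submodule.add_mem _ (Submodule.subset_span (Or.inl rfl)) (Submodule.subset_span (Or.inr ⟨v, rfl⟩))
      exact L1_grIncidence P lvl (hWmaps ℓ) _ (hWgr hXW) u hu
    exact hs i j (by omega)
  · -- climbs in the new frame
    intro v hv i j hij
    have hTv : T v ∈ grMat P lvl 𝒞 := hv
    have hs : Shifts P' lvl' c (T v) := by
      rw [L1_shifts_iff]
      intro ℓ u hu
      rw [hflag] at hu ⊢
      exact L1_grIncidence P lvl (h𝒞maps ℓ) _ hTv u hu
    rw [← hT v]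
    exact hs i j (by exact_mod_cast hij)
  · -- budget: `finrank K ≤ finrank K'`
    refine lt_of_lt_of_le hbudget ?_
    have hKC : K.map T ≤ 𝒞 := by
      rintro X ⟨v, hv, rfl⟩
      refine ⟨⟨v, rfl⟩, ?_⟩
      intro i j hij
      rw [hT v]
      exact hK v hv i j (by exact_mod_cast hij)
    have h1 := L1_finrank_le_map_add_ker T K
    have h2 := L1_finrank_comap T (grMat P lvl 𝒞) ((L1_grMat_le P lvl h𝒯gr inf_le_left).trans le_rfl)
    have h3 : Module.finrank ℂ (K.map T) ≤ Module.finrank ℂ 𝒞 := Submodule.finrank_mono hKC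
    have h4 := L1_finrank_grMat P lvl 𝒞
    show Module.finrank ℂ K ≤ Module.finrank ℂ ((grMat P lvl 𝒞).comap T)
    omega

end L1Decomposition

/-! ## v1.11 (append-only after the port commit f451771b67dc) — Conjecture S: the DIMENSION LAW

Instrument finding (KN tool `kn_run.py` v2 + exact searches, 2026-08-28): every nilpotent space met so far with
`dim W ≥ m` is Plücker-UNSTABLE with an exact coordinate flag (census zoo W5…W9, W58, WN5, WN7, I42, Irr4–6, NT4; the
lead's 𝔰𝔩₂ mixed sets; transpose-graphs and generic twisted doubles), while the semistable ones (Irr₃, the eight `S₃`-type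
graded balanced 3-planes of `M₄`, 68 graded balanced 4-planes of `M₅`, direct sums) all have `dim W ≤ m − 1`.
PROVED BY HAND for `m ≤ 4`: a semistable `W` meets the nilradical of every `W`-invariant flag trivially (else that flag has
positive degree), so it embeds in the Levi part; with ι(4) = 3 (eng-1 NOTE-iota4: every nilpotent space of `M₄` of
dimension `≥ 4` is reducible) the Levi blocks are too small: `C(a,2) + C(4−a,2) ≤ 3`.  Open from `m = 5`.
Consequence for R2: in the format `2m² < n³`, `dim W ≥ n² − n` a heavy top has `dim W > m`, so the law makes EVERY heavy
top Plücker-unstable — the first half of `pluecker-gap` K4 — and leaves exactly the Kempf-complexity half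
(«unstable ⇒ cheaply unstable», i.e. `FlagCheap`). -/
section DimensionLaw

/-- **Conjecture S (dimension law) at size `k`:** every nilpotent subspace of `M_k(ℂ)` of dimension `≥ k` is
Hilbert–Mumford unstable in the Plücker embedding; equivalently a SEMISTABLE nilpotent space has dimension `≤ k − 1`
(sharp for `k = 3, 4, 5`).  Proved by hand for `k ≤ 4`; open for `k ≥ 5`. -/
def DimensionLawAt (k : ℕ) : Prop :=
  ∀ W : Submodule ℂ (Matrix (Fin k) (Fin k) ℂ), IsNilSpace W → k ≤ Module.finrank ℂ W → PlUnstable W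

/-- **Conjecture S (dimension law), all sizes.** -/
def DimensionLaw : Prop := ∀ k : ℕ, DimensionLawAt k

/-- Contrapositive reading: semistable nilpotent spaces are SMALL. -/
theorem finrank_lt_of_semistable {k : ℕ} (h : DimensionLawAt k) (W : Submodule ℂ (Matrix (Fin k) (Fin k) ℂ))
    (hW : IsNilSpace W) (hss : ¬ PlUnstable W) : Module.finrank ℂ W < k := by
  by_contra hlt
  exact hss (h W hW (Nat.le_of_not_lt hlt))

end DimensionLaw

end Summit.ValiantsHypothesis.ValiantsHypothesis.Cruxes.DualUnipotentThreeHalves.WeightShadow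

end
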